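import Summits.PneNP.PneNP.Theses.ConvexRankGates
import Literature.Computability.Complexity.ExtMonotoneGRankSupport
import Literature.Computability.Complexity.ExtMonotoneCliqueGate
import Literature.Computability.Complexity.CircuitLowerBoundsProofs
import Literature.Computability.AlgebraicComplexity.DeterminantalComplexityProofs
import Literature.Computability.Complexity.CliqueApproximatorsWide
import Literature.Computability.Complexity.RossmanMonotoneCliqueProb

/-!
# Disproof work file for crux `LinAlgGateBlind` (stmt-PneNP-10681, route ConvexRankGates) — standing adversary, gen 2

Crux (read back as `Blind`; `linAlgGateBlind_iff : LinAlgGateBlind ↔ Blind` by `Iff.rfl`):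
`∃ δ ∈ (0, 1/2), ∀ c, ∀ᶠ m,` no circuit over `{∧₂, ∨₂} ∪ PERM_{m^c} ∪ GRANK_{m^c}` with `≤ m^c`
gates computes `CLIQUE(m, ⌈m^δ⌉₊)`; PERM = permutation-group membership on `≤ s` points, GRANK =
generic-rank threshold of an affine symbolic matrix of dimension `≤ s` over ANY field `F : Type`
(`IsPermGate`, `IsGRankGate` of `Literature/…/ExtMonotoneGates.lean`, texts identical to the
route's inline `let`s).

## Findings — everything below is PROVED (0 `sorry`); nothing here proves or refutes the crux

(a) LOAD-BEARING ANALYSIS (each hypothesis is used by any proof of the crux):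
* `not_withoutBasis` — drop `C.IsOver basis`: ONE unrestricted gate computes CLIQUE.
* `not_withoutSizeBound` — drop `C.size ≤ m^c`: the monotone DNF over `{∧₂, ∨₂} ⊆ basis` does.
* `not_withoutGRankDim` — drop `d ≤ m^c` inside GRANK: ONE GRANK gate over `ℚ` of dimension
  `1 + C(m,k)·#E(K_m)` computes `CLIQUE(m,k)`, `k ≥ 2` (`exists_oneGRankGate_computes_cliqueFn`:
  the size-tracked Valiant path-block matrix of the clique polynomial, `hasDetRepr_cliquePoly`).
* `not_withoutPermDim` — drop `d ≤ m^c` inside PERM: ONE permutation gate on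
  `2 + C(m,k)·(#E(K_m) - 1)` points computes `CLIQUE(m,k)`, `k ≥ 2`
  (`exists_onePermGate_computes_cliqueFn`: private `A–B` path per `k`-set, position `j` swaps
  nodes `j, j+1` and reads the `j`-th edge of the set; `(A B) ∈ ⟨on transpositions⟩` iff some path
  is entirely on — `swap_AB_mem_closure_iff`, invariant-set argument `setStab`).
* QUANTITATIVE: `not_blindDim_pow_kOf`, `not_blindPermOnly_pow_kOf` — with dimension / point
  budget `m^{k+3}` (`k = ⌈m^δ⌉₊`; that is `2^{O(m^δ log m)}`, subexponential in the `C(m,2)`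
  inputs) ONE GRANK gate, resp. ONE PERM gate with no GRANK at all, computes CLIQUE at every `c`:
  a proof must exploit `d ≤ m^{O(1)}` against a one-gate threshold `≤ m^{k+3}`.
* `not_blindConstK` — constant clique size `k₀`: false at `c = k₀ + 3` (growth `k → ∞` is used).
* `not_uniformThreshold` — `∃ m₀ ∀ c` instead of `∀ c ∃ m₀`: false (quantifier order is used).
* `blind_window` — the inner statement forces `0 < δ ≤ 1` (constants `1`/`0` are a PERM gate on
  `0` points / a GRANK gate of dimension `0`, in the basis at every `s`).

(b) REDUCTION + HARDNESS CERTIFICATE (what a proof of the crux also proves):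
* `not_blind_of_oneLinGate` — one `Lin(m^c)` gate computing CLIQUE i.o. for each `δ` kills the crux.
* `cktSize_shadow_of_hasDetRepr`, `exists_oneGRankGate_of_shadow` — an affine determinantal
  representation of size `d` of ANY polynomial whose monotone shadow (up-closure of its monomial
  supports) is CLIQUE is ONE `GRANK_d` gate computing CLIQUE (`detGate`, `detGate_eq_true_iff`,
  `le_rank_iff_det_ne_zero`, affine decomposition `eq_C_add_sum_X_mul_C`).
* `shadow_hasDetRepr_lowerBound_of_blindAt` — so `BlindAt δ` ⇒ over EVERY field, eventually, no
  polynomial with shadow `CLIQUE(m,⌈m^δ⌉₊)` (wild coefficients allowed) has `dc ≤ m^c`;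
* `dc_cliquePoly_superpolynomial_of_linAlgGateBlind` — HEADLINE: the crux as typed implies
  `dc(CL_{m,⌈m^δ⌉₊}) > m^c` eventually for every `c`, over every field (`cliquePoly`,
  `shadow_cliquePoly_iff`, `determinantalComplexity_cliquePoly_of_blindAt`) — a VNP ⊄ VBP-strength
  statement in every characteristic. Whoever proves crux #4 proves at least that.

(b') SPAN-PROGRAM CERTIFICATE (abelian PERM door): `transl_mem_closure_iff`, `spanProgram_isPermGate`
  — a monotone span program over `ZMod p` of dimension `D` (any number of rows / labels) is ONE PERM
  gate on `D·p` points (regular translation action, generated subgroup = `𝔽_p`-span); hence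
  `spanProgram_lowerBound_of_blindAt`: the crux implies span-program DIMENSION lower bounds for
  `CLIQUE(m,⌈m^δ⌉₊)` over every `ZMod p` with `D·p ≤ m^c` — the Pitassi–Robere-type statement the
  PERM door must re-prove (consistent with print; no refutation vector there).

(c) SMALL PRINT: `cliquePoly_of_le_one` — for `k ≤ 1` the clique polynomial is the CONSTANT
  `C(m,k)` and vanishes in characteristic `p ∣ C(m,k)` although CLIQUE ≡ 1: every shadow lemma needs
  `k ≥ 2`.

(d) TARGETS: `Sketch3Copy.not_shadowCliqueCover` — the ideator-3 first lemma `ShadowCliqueCover`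
  (`Cruxes/LinAlgGateBlind/IdeatorSketch3.lean`) is FALSE as filed (witness `m = 2, k = 1, F = 𝔽₂`:
  `CC_{2,1} = 2·∏(1 + zₑxₑ) = 0`); stub-misstated, repair: add `2 ≤ k`.

(d') TARGETS FOR THE PICKED LINE `dnf-invariant-wide-gates-see-small-cliques` (lead PICKED.md
  2026-08-16; skeleton `Lines/….lean`, six stubs). Verdicts of this seat:
  * `stub_termCollapse`, `stub_pluckingBound`, `stub_wideApproxHost`, `stub_denseRegime` — PASS (true as
    filed): degenerate corners checked on paper (`t = 0`: the input circuit computes CLIQUE only at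
    `k = 2 = m` where `Pr[clique] = q ≥ q^{C(l,2)}` kills the last budget; `k ≤ 1` constants: `Pr[clique] = 1`
    kills it; `q ∈ {0,1}`, `l ≤ 1`, `r = 0`, `𝒞 = ∅` in the plucking bound all give `0 ≤ 0` or `≤ 1·|𝒱(l)|`);
    the `δ = 1/8` calculus verified asymptotically and at `m = 2^128` (`k = 2^16`, `l = 11`, `r ≈ 1700`,
    `q^{C(l,2)} ≈ 0.74`, trimming exponent `164 - 931 + 88.7(c+1) < 0` for `c ≤ 7`, larger `c` need larger `m`).
  * `stub_sgPerm`, `stub_sgGRank` — SURVIVE (no kill), with the witness recipe PROVED here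
    (`PickedLineCopy.not_hasApprox_of_dense_of_reject`, verbatim `lostPos`/`gainedNeg`): a counterexample
    `O` must accept `> ε·C(m,k)` bare `k`-cliques AND reject `G(m,q)` with probability `> ε`
    (`hasApprox_of_card_accepted_le`, `hasApprox_of_prob_reject_le`), non-locally (skeleton's
    `sg_of_locality`), and it IS one as soon as it rejects `> 1 - q^{C(l,2)} + ε` (`≤ 1/2 + ε`) of `G(m,q)`.
    Such an `O` is a monotone DETECTOR separating dense `G(m, 1 - 4 ln m/k)` from graphs with a planted bare
    `k`-clique (`k = m^{1/8}`) on a `≥ m^{-(c+1)}`-dense family of positions; for PERM / tame GRANK (P/poly-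
    evaluable) this is planted-clique detection far below the spectral threshold `√(m/p)`, `p = 4 ln m/k`
    (conjectured hard), for wild GRANK an unknown algebraic construction — so no cheap witness exists and
    the lead's "risk: stub_sgPerm FALSE" is, concretely, the risk that planted `m^{1/8}`-clique detection
    in `G(m, 1 - Õ(m^{-1/8}))` is in P/poly.

(e) FRONTIER (documented `Prop`s, each PROVED to follow from the crux, none asserted):
  `AbelianPermDoorBlind` (known in print, not in tree) · `NonabelianPermDoorBlind` (open; NC-evaluable,
  so true unless NP ⊆ P/poly) · `GRankDoorBlind` (open, Valiant-hard:
  `hasDetRepr_cliquePoly_lowerBound_of_gRankDoorBlind`). A proof of the crux proves all three for its δ.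

LANDED in the tree (Theorems/LinAlgGateBlind/Negative/, `--supports stmt-PneNP-10681`): `DetGate.lean`
(p70294), `CliquePolyDetRepr.lean` (p70336), `OnePermGate.lean` (p70393); `ValiantCertificate.lean`
(p77028, ACCEPTED a92f9d4d8a62), `LoadBearing.lean` (p80440, submitted
after dry-run ACCEPT). Independent sibling work for crux #5 (`Theorems/CliqueExtLowerBound/
Negative/PermSpanProgram.lean`, `PermConsequences.lean`, cdisprove-10682) proves the PERM facts a second way
(cycle span program; finite abelian group programs are PERM gates; `LinLowerBoundAt` schedule refutations for
THIS crux) — cited, not duplicated; a prover's `ConvexRankGatesLinAlgGateBlindDetCompress.lean` builds the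
GRANK = DET normal form on `Negative/DetGate.lean`.

## WHY THE CRUX RESISTS REFUTATION (for provers and planners)
* PERM gates (any arity; repeated wires = one Boolean input owns a subgroup `H_e ≤ Sym(d)`) and
  TAME GRANK gates (`F = ℚ`/`𝔽_q`, poly bit-size) are P/poly-evaluable (Sims/FHL; Schwartz–Zippel
  with advice): a poly-size circuit over them computing `CLIQUE(m, m^δ)` would give NP ⊆ P/poly. A
  cheap refutation can therefore only come from WILD GRANK constants, i.e. from a poly(m)-size
  affine matrix over some field whose determinant lies in the `k`-clique monomial ideal and touches
  every `k`-clique (`not_blind_of_oneLinGate` + `exists_oneGRankGate_of_shadow`). None is known: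
  algebraically independent constants add nothing (PIT), huge integers / high-degree algebraics add
  nothing (height/degree bounds); the residual loophole is characteristic `p` with `log p`
  exponential in `m`, where the zero-pattern transfer (effective Nullstellensatz) breaks — recorded,
  not exploitable without an actual construction.
* Conversely the crux is Valiant-hard (headline), so neither side is cheap; the dimension thresholds
  say every naive one-gate construction lives at `d = m^{Θ(k)}`, and the crux sits exactly in the
  gap `m^{O(1)} ≤ d < m^{Θ(m^δ)}`.
-/

namespace Summit.PneNP.PneNP.Cruxes.LinAlgGateBlind.Disproof

open Literature.Computability.Complexity Filter MvPolynomial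

section Affine

variable {R : Type*} [CommSemiring R] {n : ℕ}

/-- A finitely supported function of degree `1` is a `single i 1`. [folklore] -/
theorem finsupp_eq_single_of_degree_eq_one {ι : Type*} (d : ι →₀ ℕ) (hd : d.degree = 1) :
    ∃ j, d = Finsupp.single j 1 := by
  classical
  have hne : d ≠ 0 := by
    rintro rfl
    simp at hd
  obtain ⟨j, hj⟩ := Finsupp.support_nonempty_iff.2 hne
  refine ⟨j, ?_⟩
  have hj1 : 1 ≤ d j := Nat.one_le_iff_ne_zero.2 (Finsupp.mem_support_iff.1 hj)
  have hsum : d.degree = ∑ i ∈ d.support, d i := rfl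
  have hle : d j ≤ ∑ i ∈ d.support, d i :=
    Finset.single_le_sum (fun i _ => Nat.zero_le (d i)) hj
  have hdj : d j = 1 := by omega
  -- all other coordinates vanish
  ext i
  by_cases hij : i = j
  · subst hij; simp [hdj]
  · rw [Finsupp.single_apply, if_neg (Ne.symm hij)]
    by_contra hi
    have hi' : i ∈ d.support := Finsupp.mem_support_iff.2 hi
    have h2 : d j + d i ≤ ∑ l ∈ d.support, d l := by
      rw [← Finset.sum_pair (Ne.symm hij)]
      exact Finset.sum_le_sum_of_subset_of_nonneg
        (by intro x hx; simp only [Finset.mem_insert, Finset.mem_singleton] at hx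
            rcases hx with rfl | rfl <;> assumption)
        (fun _ _ _ => Nat.zero_le _)
    have : 1 ≤ d i := Nat.one_le_iff_ne_zero.2 hi
    omega

/-- **Affine polynomials, coefficientwise.** A polynomial of total degree `≤ 1` in finitely many
variables is `c₀ + ∑ᵢ Xᵢ cᵢ` with `c₀` its constant coefficient and `cᵢ` the coefficient of `Xᵢ`.
[folklore] -/
theorem eq_C_add_sum_X_mul_C (a : MvPolynomial (Fin n) R) (ha : a.totalDegree ≤ 1) :
    a = C (a.coeff 0) + ∑ i, X i * C (a.coeff (Finsupp.single i 1)) := by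
  classical
  refine MvPolynomial.ext _ _ fun d => ?_
  simp only [coeff_add, coeff_C, coeff_sum]
  have hterm : ∀ i : Fin n, coeff d (X i * C (a.coeff (Finsupp.single i 1))) =
      if d = Finsupp.single i 1 then a.coeff (Finsupp.single i 1) else 0 := by
    intro i
    rw [mul_comm, coeff_C_mul, coeff_X]
    by_cases h : d = Finsupp.single i 1
    · subst h; simp
    · rw [if_neg h, if_neg (fun h' => h h'.symm), mul_zero]
  simp only [hterm]
  by_cases h0 : d = 0
  · subst h0
    have : ∀ i : Fin n, ((0 : Fin n →₀ ℕ) = Finsupp.single i 1) = False := fun i => by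
      refine propext ⟨fun h => ?_, False.elim⟩
      have := congrArg (fun f => f i) h
      simp at this
    simp [this]
  · rw [if_neg (fun h => h0 h.symm), zero_add]
    by_cases h1 : d.degree = 1
    · obtain ⟨j, rfl⟩ := finsupp_eq_single_of_degree_eq_one d h1
      rw [Finset.sum_eq_single j]
      · simp
      · intro i _ hij
        rw [if_neg]
        intro h
        exact hij (Finsupp.single_left_injective (by norm_num) h).symm
      · intro h; exact absurd (Finset.mem_univ j) h
    · -- degree ≥ 2: both sides vanish
      have hdeg : 2 ≤ d.degree := by
        have : d.degree ≠ 0 := fun h => h0 ((Finsupp.degree_eq_zero_iff d).1 h)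
        omega
      rw [coeff_eq_zero_of_totalDegree_lt]
      · symm
        refine Finset.sum_eq_zero fun i _ => ?_
        rw [if_neg]
        rintro rfl
        simp [Finsupp.degree_single] at hdeg
      · change a.totalDegree < d.degree
        omega

end Affine

section Rank

variable {K : Type*} [Field K] {d : ℕ}

/-- For a square matrix over a field: full rank iff non-zero determinant. [folklore] -/
theorem le_rank_iff_det_ne_zero (M : Matrix (Fin d) (Fin d) K) : d ≤ M.rank ↔ M.det ≠ 0 := by
  constructor
  · intro h hdet
    have hr : M.rank = d := le_antisymm (by simpa using M.rank_le_card_width) h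
    have htop : LinearMap.range M.mulVecLin = ⊤ :=
      Submodule.eq_top_of_finrank_eq (by rw [← Matrix.rank, hr]; simp)
    have hsurj : Function.Surjective M.mulVec := fun y => by
      have : y ∈ LinearMap.range M.mulVecLin := htop ▸ Submodule.mem_top
      obtain ⟨x, hx⟩ := this
      exact ⟨x, hx⟩
    have hU : IsUnit M := Matrix.mulVec_surjective_iff_isUnit.1 hsurj
    exact ((Matrix.isUnit_iff_isUnit_det M).1 hU).ne_zero hdet
  · intro h
    simpa using Literature.LinearAlgebra.Matrix.card_le_rank_of_det_submatrix_ne_zero M id id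
      (by simpa using h)

end Rank

section OneGate

variable {F : Type} [Field F] {n d : ℕ}

/-- Constant part of an affine matrix. -/
noncomputable def constPart (A : Matrix (Fin d) (Fin d) (MvPolynomial (Fin n) F)) :
    Matrix (Fin d) (Fin d) F := A.map (coeff 0)

/-- Coefficient matrix of `Xᵢ` of an affine matrix. -/
noncomputable def linPart (A : Matrix (Fin d) (Fin d) (MvPolynomial (Fin n) F)) (i : Fin n) :
    Matrix (Fin d) (Fin d) F := A.map (coeff (Finsupp.single i 1))

/-- An affine matrix IS the generic symbolic matrix of its constant part and its `Xᵢ`-coefficient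
matrices. [folklore] -/
theorem symbolicPolyMatrix_constPart_linPart (A : Matrix (Fin d) (Fin d) (MvPolynomial (Fin n) F))
    (hA : ∀ p q, (A p q).totalDegree ≤ 1) :
    symbolicPolyMatrix (constPart A) (linPart A) = A := by
  ext p q
  simp only [symbolicPolyMatrix, constPart, linPart, Matrix.add_apply, Matrix.map_apply,
    Matrix.sum_apply, Matrix.smul_apply, smul_eq_mul]
  conv_rhs => rw [eq_C_add_sum_X_mul_C (A p q) (hA p q)]

/-- The GRANK gate of an affine `d × d` matrix `A` in `n` variables: arity `n`, accepts `v` iff the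
generic rank of `A` with the unselected variables killed is `d`. -/
noncomputable def detGate (A : Matrix (Fin d) (Fin d) (MvPolynomial (Fin n) F)) : GateFn :=
  ⟨n, fun v => decide (d ≤ (symbolicMatrix (constPart A) (linPart A) v).rank)⟩

/-- `detGate A` is a GRANK gate of dimension `d` (field `F`, threshold `θ = d`). -/
theorem detGate_isGRankGate (A : Matrix (Fin d) (Fin d) (MvPolynomial (Fin n) F)) :
    IsGRankGate d (detGate A) :=
  ⟨F, inferInstance, d, d, le_rfl, constPart A, linPart A, fun _ => decide_eq_true_iff⟩

/-- **Semantics of the determinant gate**: for an affine matrix `A` with `det A = P`, the gate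
accepts `v` iff some monomial of `P` has all its variables switched on in `v` (the monotone
SHADOW / support up-closure of `P`). [folklore] -/
theorem detGate_eq_true_iff (A : Matrix (Fin d) (Fin d) (MvPolynomial (Fin n) F))
    (hA : ∀ p q, (A p q).totalDegree ≤ 1) (v : Fin n → Bool) :
    (detGate A).2 v = true ↔ ∃ s ∈ (A.det).support, ∀ i ∈ s.support, v i = true := by
  simp only [detGate, decide_eq_true_eq]
  rw [le_rank_iff_det_ne_zero, ← Matrix.submatrix_id_id (symbolicMatrix _ _ v), Ne,
    det_submatrix_symbolicMatrix_eq_zero_iff, Matrix.submatrix_id_id,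
    symbolicPolyMatrix_constPart_linPart A hA, ← Ne, killVars_ne_zero_iff]

end OneGate


/-! ### Size-tracked Valiant gadgets (ABP → determinant) -/

section Gadget

variable {R : Type*} [CommRing R] {σ : Type*}

/-- A *gadget of size `N`* for `g`: an affine `N × N` matrix `M` (up to the index type) with a
distinguished index `z` such that `det (M + c E_{zz}) = c + g` for all `c` (Valiant's ABP matrix
with source and sink glued at `z`); the size-tracked form of the tree's universality gadgets. -/
def GadgetC (N : ℕ) (g : MvPolynomial σ R) : Prop :=
  ∃ (ι : Type) (_ : Fintype ι) (_ : DecidableEq ι), Fintype.card ι = N ∧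
    ∃ (z : ι) (M : Matrix ι ι (MvPolynomial σ R)),
      (∀ p q, (M p q).totalDegree ≤ 1) ∧ ∀ c, (M + Matrix.single z z c).det = c + g

/-- The `1 × 1` zero matrix is a gadget of size `1` for `0`. [folklore] -/
theorem gadgetC_zero : GadgetC 1 (0 : MvPolynomial σ R) :=
  ⟨Unit, inferInstance, inferInstance, by simp, (), 0, fun p q => by simp, fun c => by
    simp [Matrix.det_unique]⟩

/-- Adding an affine form costs nothing. [folklore] -/
theorem gadgetC_add_affine {N : ℕ} {g a : MvPolynomial σ R} (ha : a.totalDegree ≤ 1)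
    (h : GadgetC N g) : GadgetC N (g + a) := by
  obtain ⟨ι, _, _, hN, z, M, hdeg, hdet⟩ := h
  refine ⟨ι, inferInstance, inferInstance, hN, z, M + Matrix.single z z a, fun p q => ?_,
    fun c => ?_⟩
  · rw [Matrix.add_apply, Matrix.single_apply]
    split_ifs
    · exact (totalDegree_add _ _).trans (max_le (hdeg p q) ha)
    · rw [add_zero]
      exact hdeg p q
  · rw [add_assoc, ← Matrix.single_add, hdet]
    ring

/-- Adding a product of `t + 2` affine forms costs `t + 1` rows (the path block of
`det_pathBorder_add_single`; Valiant 1979, §2). [folklore] -/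
theorem gadgetC_add_prod {N : ℕ} {g : MvPolynomial σ R} (y : ℕ → MvPolynomial σ R)
    (hy : ∀ i, (y i).totalDegree ≤ 1) (t : ℕ) (h : GadgetC N g) :
    GadgetC (N + (t + 1)) (g + ∏ i ∈ Finset.range (t + 2), y i) := by
  obtain ⟨ι, _, _, hN, z, M, hdeg, hdet⟩ := h
  let U : Matrix (Fin (t + 1)) (Fin (t + 1)) (MvPolynomial σ R) := Matrix.of fun a b =>
    if (b : ℕ) = a then 1 else if (b : ℕ) = a + 1 then -y b else 0
  let W : Matrix (Fin (t + 1)) (Fin (t + 1)) (MvPolynomial σ R) := Matrix.of fun a b =>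
    if (a : ℕ) ≤ b then ∏ i ∈ Finset.Ioc (a : ℕ) b, y i else 0
  have hU : ∀ a b, U a b = if (b : ℕ) = a then 1 else if (b : ℕ) = a + 1 then -y b else 0 :=
    fun a b => rfl
  have hW : ∀ a b, W a b = if (a : ℕ) ≤ b then ∏ i ∈ Finset.Ioc (a : ℕ) b, y i else 0 :=
    fun a b => rfl
  refine ⟨ι ⊕ Fin (t + 1), inferInstance, inferInstance, by simp [Fintype.card_sum, hN],
    Sum.inl z,
    Matrix.fromBlocks M (Matrix.single z (0 : Fin (t + 1)) (-y 0))
      (Matrix.single (Fin.last t) z (y (t + 1))) U, ?_, fun c => ?_⟩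
  · rintro (p | p) (q | q)
    · rw [Matrix.fromBlocks_apply₁₁]
      exact hdeg p q
    · rw [Matrix.fromBlocks_apply₁₂, Matrix.single_apply]
      split_ifs
      · rw [totalDegree_neg]
        exact hy 0
      · simp
    · rw [Matrix.fromBlocks_apply₂₁, Matrix.single_apply]
      split_ifs
      · exact hy (t + 1)
      · simp
    · rw [Matrix.fromBlocks_apply₂₂, hU]
      split_ifs
      · simp
      · rw [totalDegree_neg]
        exact hy q
      · simp
  · rw [Literature.Computability.AlgebraicComplexity.det_pathBorder_add_single M z y c hU hW, hdet]
    ring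

/-- Adding the product of a list of affine forms costs `|l| - 1` rows. [folklore] -/
theorem gadgetC_add_listProd {N : ℕ} {g : MvPolynomial σ R} (l : List (MvPolynomial σ R))
    (hl : ∀ y ∈ l, y.totalDegree ≤ 1) (h : GadgetC N g) :
    GadgetC (N + (l.length - 1)) (g + l.prod) := by
  rcases l with _ | ⟨x, _ | ⟨x', rest⟩⟩
  · rw [List.prod_nil]
    exact gadgetC_add_affine (by simp) h
  · rw [List.prod_cons, List.prod_nil, mul_one]
    exact gadgetC_add_affine (hl x (by simp)) h
  · have hy : ∀ i, ((x :: x' :: rest).getD i 1).totalDegree ≤ 1 := by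
      intro i
      rw [List.getD_eq_getElem?_getD]
      by_cases hi : i < (x :: x' :: rest).length
      · rw [List.getElem?_eq_getElem hi, Option.getD_some]
        exact hl _ (List.getElem_mem hi)
      · rw [List.getElem?_eq_none (by omega), Option.getD_none]
        simp
    have := gadgetC_add_prod (fun i => (x :: x' :: rest).getD i 1) hy rest.length h
    rwa [show rest.length + 2 = (x :: x' :: rest).length by simp,
      Literature.Computability.AlgebraicComplexity.prod_range_getD_one] at this

/-- Adding a finite sum of list-products of affine forms, lists of length `≤ B + 1`: at most
`B` rows per summand. [folklore] -/
theorem gadgetC_add_sum_listProd {α : Type*} [DecidableEq α] (s : Finset α)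
    (ls : α → List (MvPolynomial σ R)) (B : ℕ) (hl : ∀ a ∈ s, ∀ y ∈ ls a, y.totalDegree ≤ 1)
    (hB : ∀ a ∈ s, (ls a).length ≤ B + 1) {N : ℕ} {g : MvPolynomial σ R} (h : GadgetC N g) :
    ∃ N', N' ≤ N + s.card * B ∧ GadgetC N' (g + ∑ a ∈ s, (ls a).prod) := by
  induction s using Finset.induction_on generalizing N g with
  | empty => exact ⟨N, by simp, by simpa using h⟩
  | insert a s has ih =>
    obtain ⟨N', hN', hg'⟩ := ih (fun b hb => hl b (Finset.mem_insert_of_mem hb))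
      (fun b hb => hB b (Finset.mem_insert_of_mem hb)) h
    have h2 := gadgetC_add_listProd (ls a) (hl a (Finset.mem_insert_self a s)) hg'
    refine ⟨N' + ((ls a).length - 1), ?_, ?_⟩
    · have := hB a (Finset.mem_insert_self a s)
      rw [Finset.card_insert_of_notMem has]
      have : (ls a).length - 1 ≤ B := by omega
      nlinarith
    · rwa [Finset.sum_insert has, add_comm (ls a).prod, ← add_assoc]

/-- A gadget of size `N` for `f` is an affine determinantal representation of size `N`. -/
theorem hasDetRepr_of_gadgetC {N : ℕ} {f : MvPolynomial σ R} (h : GadgetC N f) :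
    Literature.Computability.AlgebraicComplexity.HasDetRepr f N := by
  obtain ⟨ι, _, _, hN, z, M, hdeg, hdet⟩ := h
  subst hN
  refine ⟨Matrix.reindex (Fintype.equivFin ι) (Fintype.equivFin ι) M, fun i j => ?_, ?_⟩
  · rw [Matrix.reindex_apply, Matrix.submatrix_apply]
    exact hdeg _ _
  · rw [Matrix.det_reindex_self]
    simpa using hdet 0

end Gadget

/-! ### The clique polynomial and its monotone shadow -/

section CliquePoly

open Finset

variable (m : ℕ)

/-- Indices (under the enumeration `eE m`) of the edges of `K_m` inside the vertex set `T`. -/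
noncomputable def liveIdx (T : Finset (Fin m)) : Finset (Fin (CliqueLPGate.nE m)) :=
  univ.filter fun i => IsLive T ((CliqueLPGate.eE m).symm i)

/-- The exponent vector of the clique monomial of `T`: the indicator of `liveIdx m T`. -/
noncomputable def liveSupp (T : Finset (Fin m)) : Fin (CliqueLPGate.nE m) →₀ ℕ :=
  ∑ i ∈ liveIdx m T, Finsupp.single i 1

theorem liveSupp_apply (T : Finset (Fin m)) (i : Fin (CliqueLPGate.nE m)) :
    liveSupp m T i = if i ∈ liveIdx m T then 1 else 0 := by
  rw [liveSupp, Finsupp.finsetSum_apply]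
  simp only [Finsupp.single_apply]
  rw [Finset.sum_ite_eq']

theorem mem_support_liveSupp (T : Finset (Fin m)) (i : Fin (CliqueLPGate.nE m)) :
    i ∈ (liveSupp m T).support ↔ IsLive T ((CliqueLPGate.eE m).symm i) := by
  rw [Finsupp.mem_support_iff, liveSupp_apply]
  simp [liveIdx]

/-- The product of the live edge variables is the clique monomial. [folklore] -/
theorem prod_X_eq_monomial {R : Type*} [CommSemiring R] (S : Finset (Fin (CliqueLPGate.nE m))) :
    ∏ i ∈ S, (X i : MvPolynomial (Fin (CliqueLPGate.nE m)) R) =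
      monomial (∑ i ∈ S, Finsupp.single i 1) 1 := by
  induction S using Finset.induction_on with
  | empty => simp
  | insert a S ha ih =>
    rw [Finset.prod_insert ha, Finset.sum_insert ha, ih, X, monomial_mul, one_mul]

variable (F : Type) [Field F]

/-- **The clique polynomial** `CL_{m,k} = ∑_{|T| = k} ∏_{e ⊆ T} X_e` over `F`, in the edge variables
of `K_m` enumerated by `eE m` (Bürgisser 2000, §3: the clique family; here with all coefficients `1`). -/
noncomputable def cliquePoly (k : ℕ) : MvPolynomial (Fin (CliqueLPGate.nE m)) F :=
  ∑ T ∈ powersetCard k univ, monomial (liveSupp m T) 1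

variable {m F}

/-- For `|T|, |T'| ≥ 2`, equal live-edge sets force `T = T'`. [folklore] -/
theorem eq_of_liveSupp_eq {T T' : Finset (Fin m)} (hT : 2 ≤ T.card) (hT' : 2 ≤ T'.card)
    (h : liveSupp m T = liveSupp m T') : T = T' := by
  have key : ∀ {A B : Finset (Fin m)}, 2 ≤ A.card → liveSupp m A = liveSupp m B → A ⊆ B := by
    intro A B hA hAB u hu
    obtain ⟨w, hw, hwu⟩ := Finset.exists_mem_ne (by omega : 1 < A.card) u
    have he : s(u, w) ∈ (⊤ : SimpleGraph (Fin m)).edgeSet := (SimpleGraph.mem_edgeSet _).2 hwu.symm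
    have hlive : IsLive A ⟨s(u, w), he⟩ := (isLive_mk he).2 ⟨hu, hw⟩
    have h1 : (CliqueLPGate.eE m ⟨s(u, w), he⟩) ∈ (liveSupp m A).support := by
      rw [mem_support_liveSupp]; simpa using hlive
    rw [hAB, mem_support_liveSupp] at h1
    simp only [Equiv.symm_apply_apply] at h1
    exact ((isLive_mk he).1 h1).1
  exact Finset.Subset.antisymm (key hT h) (key hT' h.symm)

/-- Coefficients of the clique polynomial (`k ≥ 2`): the clique monomials have coefficient `1`. -/
theorem coeff_cliquePoly_liveSupp {k : ℕ} (hk : 2 ≤ k) {T : Finset (Fin m)} (hT : T.card = k) :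
    coeff (liveSupp m T) (cliquePoly m F k) = 1 := by
  rw [cliquePoly, coeff_sum, Finset.sum_eq_single T]
  · simp
  · intro T' hT' hne
    rw [coeff_monomial, if_neg]
    intro h
    exact hne (eq_of_liveSupp_eq (by rw [(mem_powersetCard.1 hT').2]; exact hk) (by omega) h)
  · intro h
    exact absurd (mem_powersetCard.2 ⟨subset_univ _, hT⟩) h

/-- The support of the clique polynomial (`k ≥ 2`) is the set of clique exponent vectors. -/
theorem mem_support_cliquePoly_iff {k : ℕ} (hk : 2 ≤ k) (s : Fin (CliqueLPGate.nE m) →₀ ℕ) :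
    s ∈ (cliquePoly m F k).support ↔ ∃ T : Finset (Fin m), T.card = k ∧ liveSupp m T = s := by
  constructor
  · intro hs
    rw [mem_support_iff, cliquePoly, coeff_sum] at hs
    obtain ⟨T, hT, hne⟩ := Finset.exists_ne_zero_of_sum_ne_zero hs
    rw [coeff_monomial] at hne
    by_cases h : liveSupp m T = s
    · exact ⟨T, (mem_powersetCard.1 hT).2, h⟩
    · exact absurd (if_neg h) hne
  · rintro ⟨T, hT, rfl⟩
    rw [mem_support_iff, coeff_cliquePoly_liveSupp hk hT]
    exact one_ne_zero

/-- **The monotone shadow of the clique polynomial is CLIQUE** (`k ≥ 2`): some monomial of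
`CL_{m,k}` has all its variables on in `x` iff `x` spans a `k`-clique. [folklore] -/
theorem shadow_cliquePoly_iff {k : ℕ} (hk : 2 ≤ k) (x : (⊤ : SimpleGraph (Fin m)).edgeSet → Bool) :
    (∃ s ∈ (cliquePoly m F k).support, ∀ i ∈ s.support, x ((CliqueLPGate.eE m).symm i) = true) ↔
      cliqueFn m k x = true := by
  rw [cliqueFn_eq_true_iff_exists]
  constructor
  · rintro ⟨s, hs, hx⟩
    obtain ⟨T, hT, rfl⟩ := (mem_support_cliquePoly_iff hk s).1 hs
    refine ⟨T, hT, fun e he => ?_⟩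
    have := hx (CliqueLPGate.eE m e) (by rw [mem_support_liveSupp]; simpa using he)
    simpa using this
  · rintro ⟨T, hT, hx⟩
    refine ⟨liveSupp m T, (mem_support_cliquePoly_iff hk _).2 ⟨T, hT, rfl⟩, fun i hi => ?_⟩
    exact hx _ ((mem_support_liveSupp m T i).1 hi)

/-- In contrast, for `k ≤ 1` the clique polynomial is the CONSTANT `C(m, k)`, which vanishes in
characteristic `p ∣ C(m,k)` although `CLIQUE(m, k) ≡ 1` (`m ≥ 1`): the hypothesis `2 ≤ k` above is
necessary. [folklore] -/
theorem cliquePoly_of_le_one {k : ℕ} (hk : k ≤ 1) :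
    cliquePoly m F k = C ((m.choose k : ℕ) : F) := by
  have h0 : ∀ T ∈ powersetCard k (univ : Finset (Fin m)), liveSupp m T = 0 := by
    intro T hT
    ext i
    rw [liveSupp_apply, Finsupp.coe_zero, Pi.zero_apply]
    rw [if_neg]
    simp only [liveIdx, mem_filter, mem_univ, true_and]
    intro hlive
    have hc : T.card ≤ 1 := by rw [(mem_powersetCard.1 hT).2]; exact hk
    revert hlive
    refine edge_ind (P := fun e => IsLive T e → False) (fun u v huv hl => ?_) _
    rw [isLive_mk] at hl
    exact huv (Finset.card_le_one.1 hc u hl.1 v hl.2)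
  rw [cliquePoly, Finset.sum_congr rfl fun T hT => by rw [h0 T hT], Finset.sum_const,
    card_powersetCard, card_univ, Fintype.card_fin, ← C_apply, C_1, nsmul_eq_mul, mul_one]
  exact (map_natCast C _).symm

/-- **`dc(CL_{m,k}) ≤ 1 + C(m,k) · #E(K_m)`**: an explicit affine determinantal representation of
the clique polynomial (one Valiant path block per `k`-set). [folklore] -/
theorem hasDetRepr_cliquePoly (k : ℕ) :
    Literature.Computability.AlgebraicComplexity.HasDetRepr (cliquePoly m F k)
      (1 + m.choose k * CliqueLPGate.nE m) := by
  classical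
  let ls : Finset (Fin m) → List (MvPolynomial (Fin (CliqueLPGate.nE m)) F) := fun T =>
    (liveIdx m T).toList.map X
  have hprod : ∀ T, (ls T).prod = monomial (liveSupp m T) 1 := fun T => by
    simp only [ls, Finset.prod_map_toList, liveSupp, prod_X_eq_monomial]
  obtain ⟨N', hN', hG⟩ := gadgetC_add_sum_listProd (powersetCard k (univ : Finset (Fin m))) ls
    (CliqueLPGate.nE m) (fun T _ y hy => by
      obtain ⟨i, -, rfl⟩ := List.mem_map.1 hy
      exact (isHomogeneous_X F i).totalDegree_le)
    (fun T _ => by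
      simp only [ls, List.length_map, Finset.length_toList]
      exact (Finset.card_filter_le _ _).trans (by simp))
    gadgetC_zero
  have hrepr := hasDetRepr_of_gadgetC hG
  simp only [hprod, zero_add] at hrepr
  rw [card_powersetCard, card_univ, Fintype.card_fin] at hN'
  exact Literature.Computability.AlgebraicComplexity.HasDetRepr.mono_holds hrepr hN'

end CliquePoly


/-! ### The crux, read back with named gate classes -/

section Statement

/-- `Lin s = PERM_s ∪ GRANK_s`, the wide gates of the crux (texts of `IsPermGate`, `IsGRankGate`
are literally the inline `let` of the route file). -/
def Lin (s : ℕ) : Set GateFn := {g | IsPermGate s g ∨ IsGRankGate s g}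

/-- The basis of the crux: `{∧₂, ∨₂} ∪ Lin s`. -/
def basis (s : ℕ) : Set GateFn := {GateFn.and 2, GateFn.or 2} ∪ Lin s

/-- The clique size `k = ⌈m^δ⌉₊`. -/
noncomputable def kOf (δ : ℝ) (m : ℕ) : ℕ := ⌈(m : ℝ) ^ δ⌉₊

/-- The inner statement of the crux at exponent `δ`. -/
def BlindAt (δ : ℝ) : Prop :=
  ∀ c : ℕ, ∀ᶠ m : ℕ in atTop, ∀ C : Circuit ((⊤ : SimpleGraph (Fin m)).edgeSet),
    C.IsOver (basis (m ^ c)) → C.size ≤ m ^ c → ¬ C.Computes (cliqueFn m (kOf δ m))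

/-- The crux with named pieces. -/
def Blind : Prop := ∃ δ : ℝ, 0 < δ ∧ δ < 1 / 2 ∧ BlindAt δ

/-- **Read-back.** The crux `LinAlgGateBlind` IS `Blind`, by `Iff.rfl`: the inline gate classes are
`IsPermGate`/`IsGRankGate` of `ExtMonotoneGates.lean` and the inline clique function is `cliqueFn`. -/
theorem linAlgGateBlind_iff :
    Summit.PneNP.PneNP.Theses.ConvexRankGates.LinAlgGateBlind ↔ Blind := Iff.rfl

variable {s : ℕ}

theorem isGRankGate_subset_basis : {g | IsGRankGate s g} ⊆ basis s := fun _ hg => Or.inr (Or.inr hg)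

theorem isPermGate_subset_basis : {g | IsPermGate s g} ⊆ basis s := fun _ hg => Or.inr (Or.inl hg)

theorem monotoneBasis_subset_basis : monotoneBasis ⊆ basis s := Set.subset_union_left

theorem basis_mono {s t : ℕ} (hst : s ≤ t) : basis s ⊆ basis t := by
  rintro g (hg | hg | hg)
  · exact Or.inl hg
  · exact Or.inr (Or.inl (hg.mono hst))
  · exact Or.inr (Or.inr (hg.mono hst))

/-- The constant `true` (any arity) is a PERM gate on `0` points (`τ = 1`). -/
theorem isPermGate_const_true (s n : ℕ) : IsPermGate s ⟨n, fun _ => true⟩ :=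
  ⟨0, Nat.zero_le _, fun _ => 1, 1, fun _ => by simp⟩

/-- The constant `false` (any arity) is a GRANK gate of dimension `0` (`θ = 1`, `F = ℚ`). -/
theorem isGRankGate_const_false (s n : ℕ) : IsGRankGate s ⟨n, fun _ => false⟩ := by
  refine ⟨ℚ, inferInstance, 0, 1, Nat.zero_le _, 0, fun _ => 0, fun v => ?_⟩
  simp only [Bool.false_eq_true, false_iff, not_le]
  have := (symbolicMatrix (0 : Matrix (Fin 0) (Fin 0) ℚ) (fun _ : Fin n => 0) v).rank_le_card_width
  simp only [Fintype.card_fin] at this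
  omega

/-- The constant circuit is a `basis s`-circuit of size `1`, for every `s`. -/
theorem const_isOver_basis (ι : Type) (b : Bool) (s : ℕ) : (Circuit.const ι b).IsOver (basis s) := by
  intro g hg
  simp only [Circuit.const, List.mem_singleton] at hg
  subst hg
  cases b
  · exact isGRankGate_subset_basis (isGRankGate_const_false s 0)
  · exact isPermGate_subset_basis (isPermGate_const_true s 0)

end Statement

/-! ### One GRANK gate from a determinantal representation -/

section OneGateCircuits

variable {F : Type} [Field F]

/-- **One-gate lemma.** An affine determinantal representation of size `d` of a polynomial `P` in
`n` variables gives, for any wiring of the variables to inputs, a size-`1` circuit over `GRANK_d`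
computing the monotone shadow `x ↦ [some monomial of P has all its variables on]`. [folklore] -/
theorem cktSize_shadow_of_hasDetRepr {n d : ℕ} {P : MvPolynomial (Fin n) F}
    (h : Literature.Computability.AlgebraicComplexity.HasDetRepr P d) {ι : Type*} (w : Fin n → ι) :
    CktSize {g | IsGRankGate d g}
      (fun (x : ι → Bool) (_ : Unit) => decide (∃ s ∈ P.support, ∀ i ∈ s.support, x (w i) = true))
      1 := by
  obtain ⟨A, hA, hdet⟩ := h
  refine (CktSize.gate (B := {g | IsGRankGate d g}) (detGate A) (detGate_isGRankGate A) w).congr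
    fun x _ => ?_
  apply Bool.eq_iff_iff.2
  rw [detGate_eq_true_iff A hA, decide_eq_true_iff, hdet]

/-- If the shadow of `P` (edge variables enumerated by `eE m`) is `CLIQUE(m,k)`, an affine
determinantal representation of size `d` of `P` is ONE `GRANK_d` gate computing `CLIQUE(m,k)`. -/
theorem exists_oneGRankGate_of_shadow {m k d : ℕ} {P : MvPolynomial (Fin (CliqueLPGate.nE m)) F}
    (hP : ∀ x, (∃ s ∈ P.support, ∀ i ∈ s.support, x ((CliqueLPGate.eE m).symm i) = true) ↔
      cliqueFn m k x = true)
    (h : Literature.Computability.AlgebraicComplexity.HasDetRepr P d) :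
    ∃ C : Circuit ((⊤ : SimpleGraph (Fin m)).edgeSet),
      C.IsOver {g | IsGRankGate d g} ∧ C.size ≤ 1 ∧ C.Computes (cliqueFn m k) := by
  obtain ⟨C, hC, hs, he⟩ := (cktSize_shadow_of_hasDetRepr h fun i => (CliqueLPGate.eE m).symm i).toCircuit
  refine ⟨C, hC, hs, fun x => ?_⟩
  rw [he x]
  apply Bool.eq_iff_iff.2
  rw [decide_eq_true_iff, hP x]

/-- **`CLIQUE(m,k)` is ONE GRANK gate of dimension `d` whenever `dc(CL_{m,k}) ≤ d`** (`k ≥ 2`). -/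
theorem exists_oneGRankGate_of_hasDetRepr_cliquePoly {m k d : ℕ} (hk : 2 ≤ k)
    (h : Literature.Computability.AlgebraicComplexity.HasDetRepr (cliquePoly m F k) d) :
    ∃ C : Circuit ((⊤ : SimpleGraph (Fin m)).edgeSet),
      C.IsOver {g | IsGRankGate d g} ∧ C.size ≤ 1 ∧ C.Computes (cliqueFn m k) :=
  exists_oneGRankGate_of_shadow (shadow_cliquePoly_iff hk) h

/-- **Unconditionally: `CLIQUE(m,k)` is ONE GRANK gate (over `ℚ`) of dimension
`1 + C(m,k) · #E(K_m)`** (`k ≥ 2`). [folklore] -/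
theorem exists_oneGRankGate_computes_cliqueFn (m k : ℕ) (hk : 2 ≤ k) :
    ∃ C : Circuit ((⊤ : SimpleGraph (Fin m)).edgeSet),
      C.IsOver {g | IsGRankGate (1 + m.choose k * CliqueLPGate.nE m) g} ∧ C.size ≤ 1 ∧
        C.Computes (cliqueFn m k) :=
  exists_oneGRankGate_of_hasDetRepr_cliquePoly hk (hasDetRepr_cliquePoly (F := ℚ) k)

end OneGateCircuits

/-! ### Elementary facts about `k = ⌈m^δ⌉₊` and the constant regimes of CLIQUE -/

section Params

theorem two_le_kOf {δ : ℝ} (hδ : 0 < δ) {m : ℕ} (hm : 2 ≤ m) : 2 ≤ kOf δ m := by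
  have h1 : (1 : ℝ) < (m : ℝ) ^ δ := Real.one_lt_rpow (by exact_mod_cast hm) hδ
  have : 1 < kOf δ m := Nat.lt_ceil.2 (by exact_mod_cast h1)
  omega

theorem kOf_le_self {δ : ℝ} (hδ : δ ≤ 1) {m : ℕ} (hm : 1 ≤ m) : kOf δ m ≤ m := by
  refine Nat.ceil_le.2 ?_
  have h := Real.rpow_le_rpow_of_exponent_le (x := (m : ℝ)) (by exact_mod_cast hm) hδ
  rwa [Real.rpow_one] at h

theorem kOf_le_one {δ : ℝ} (hδ : δ ≤ 0) {m : ℕ} (hm : 1 ≤ m) : kOf δ m ≤ 1 := by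
  refine Nat.ceil_le.2 ?_
  have := Real.rpow_le_one_of_one_le_of_nonpos (x := (m : ℝ)) (by exact_mod_cast hm) hδ
  exact_mod_cast this

theorem lt_kOf {δ : ℝ} (hδ : 1 < δ) {m : ℕ} (hm : 2 ≤ m) : m < kOf δ m := by
  refine Nat.lt_ceil.2 ?_
  have h := Real.rpow_lt_rpow_of_exponent_lt (x := (m : ℝ)) (by exact_mod_cast hm) hδ
  rwa [Real.rpow_one] at h

variable {m : ℕ}

/-- `CLIQUE(m, k) ≡ 1` for `k ≤ 1 ≤ m`. [folklore] -/
theorem cliqueFn_eq_true_of_le_one {k : ℕ} (hk : k ≤ 1) (hm : 1 ≤ m)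
    (x : (⊤ : SimpleGraph (Fin m)).edgeSet → Bool) : cliqueFn m k x = true := by
  rw [cliqueFn_eq_true_iff]
  interval_cases k
  · exact SimpleGraph.not_cliqueFree_zero
  · rw [SimpleGraph.cliqueFree_one, not_isEmpty_iff]
    exact ⟨⟨0, hm⟩⟩

/-- `CLIQUE(m, k) ≡ 0` for `k > m`. [folklore] -/
theorem cliqueFn_eq_false_of_lt {k : ℕ} (hk : m < k) (x : (⊤ : SimpleGraph (Fin m)).edgeSet → Bool) :
    cliqueFn m k x = false := by
  rw [cliqueFn_eq_false_iff]
  exact SimpleGraph.cliqueFree_of_card_lt (by simpa using hk)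

/-- Dimension bookkeeping: `1 + C(m,k) · #E(K_m) ≤ m^{k+3}` for `m ≥ 2`. [folklore] -/
theorem one_add_choose_mul_nE_le {m : ℕ} (hm : 2 ≤ m) (k : ℕ) :
    1 + m.choose k * CliqueLPGate.nE m ≤ m ^ (k + 3) := by
  have h1 : m.choose k ≤ m ^ k := Nat.choose_le_pow m k
  have h2 : CliqueLPGate.nE m ≤ m ^ 2 := CliqueLPGate.nE_le m
  have h3 : 1 ≤ m ^ (k + 2) := Nat.one_le_pow _ _ (by omega)
  calc 1 + m.choose k * CliqueLPGate.nE m ≤ m ^ (k + 2) + m ^ k * m ^ 2 := by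
        gcongr
    _ = 2 * m ^ (k + 2) := by ring
    _ ≤ m * m ^ (k + 2) := Nat.mul_le_mul_right _ hm
    _ = m ^ (k + 3) := by ring

end Params

/-! ### Filter plumbing -/

section FilterAux

theorem not_eventually_of_forall_ge {P : ℕ → Prop} (m₀ : ℕ) (h : ∀ m ≥ m₀, ¬ P m) :
    ¬ ∀ᶠ m in atTop, P m := fun hev => by
  obtain ⟨m, hm1, hm2⟩ := (hev.and (eventually_ge_atTop m₀)).exists
  exact h m hm2 hm1

/-- A witness circuit for all large `m` (or just frequently) kills `BlindAt δ` at one `c`. -/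
theorem not_blindAt_of_frequently {δ : ℝ} (c : ℕ)
    (h : ∃ᶠ m in atTop, ∃ C : Circuit ((⊤ : SimpleGraph (Fin m)).edgeSet),
      C.IsOver (basis (m ^ c)) ∧ C.size ≤ m ^ c ∧ C.Computes (cliqueFn m (kOf δ m))) :
    ¬ BlindAt δ := fun hB => by
  obtain ⟨m, ⟨C, hC, hs, hc⟩, hm⟩ := (h.and_eventually (hB c)).exists
  exact hm C hC hs hc

end FilterAux

/-! ### (a) LOAD-BEARING ANALYSIS — each hypothesis of the crux is necessary -/

section LoadBearing

/-- The crux WITHOUT the basis restriction `C.IsOver (basis (m^c))`. -/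
def WithoutBasis : Prop :=
  ∃ δ : ℝ, 0 < δ ∧ δ < 1 / 2 ∧ ∀ c : ℕ, ∀ᶠ m : ℕ in atTop,
    ∀ C : Circuit ((⊤ : SimpleGraph (Fin m)).edgeSet), C.size ≤ m ^ c →
      ¬ C.Computes (cliqueFn m (kOf δ m))

/-- **Any proof must use the basis restriction**: one unrestricted gate of fan-in `#E(K_m)`
computes CLIQUE. -/
theorem not_withoutBasis : ¬ WithoutBasis := by
  rintro ⟨δ, -, -, h⟩
  refine not_eventually_of_forall_ge 1 (fun m hm hP => ?_) (h 0)
  obtain ⟨C, -, hs, he⟩ := (CktSize.gate (B := Set.univ) (CliqueLPGate.cliqueGate m (kOf δ m))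
    trivial (fun a => (CliqueLPGate.eE m).symm a)).toCircuit
  refine hP C (by simpa using hs) fun x => ?_
  rw [he x]
  show cliqueFn m (kOf δ m) (fun e => x ((CliqueLPGate.eE m).symm (CliqueLPGate.eE m e))) = _
  simp

/-- The crux WITHOUT the size bound `C.size ≤ m ^ c`. -/
def WithoutSizeBound : Prop :=
  ∃ δ : ℝ, 0 < δ ∧ δ < 1 / 2 ∧ ∀ c : ℕ, ∀ᶠ m : ℕ in atTop,
    ∀ C : Circuit ((⊤ : SimpleGraph (Fin m)).edgeSet), C.IsOver (basis (m ^ c)) →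
      ¬ C.Computes (cliqueFn m (kOf δ m))

/-- **Any proof must use the size bound**: the monotone DNF over `{∧₂, ∨₂} ⊆ basis` computes
CLIQUE (tree: `exists_monotone_computes_cliqueFn_holds`). -/
theorem not_withoutSizeBound : ¬ WithoutSizeBound := by
  rintro ⟨δ, hδ0, hδ1, h⟩
  refine not_eventually_of_forall_ge 2 (fun m hm hP => ?_) (h 0)
  obtain ⟨C, hC, hc⟩ := exists_monotone_computes_cliqueFn_holds (two_le_kOf hδ0 hm)
    (kOf_le_self (by linarith) (by omega))
  exact hP C (hC.mono monotoneBasis_subset_basis) hc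

/-- GRANK gates of unrestricted dimension. -/
def GRankAnyDim (g : GateFn) : Prop := ∃ t, IsGRankGate t g

/-- The basis with the dimension bound dropped from GRANK (PERM keeps `d ≤ s`). -/
def basisNoGRankDim (s : ℕ) : Set GateFn :=
  {GateFn.and 2, GateFn.or 2} ∪ {g | IsPermGate s g ∨ GRankAnyDim g}

/-- The crux WITHOUT the dimension bound `d ≤ m^c` on GRANK gates. -/
def WithoutGRankDim : Prop :=
  ∃ δ : ℝ, 0 < δ ∧ δ < 1 / 2 ∧ ∀ c : ℕ, ∀ᶠ m : ℕ in atTop,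
    ∀ C : Circuit ((⊤ : SimpleGraph (Fin m)).edgeSet), C.IsOver (basisNoGRankDim (m ^ c)) →
      C.size ≤ m ^ c → ¬ C.Computes (cliqueFn m (kOf δ m))

/-- **Any proof must use the dimension bound of the GRANK gates**: ONE GRANK gate over `ℚ` of
dimension `1 + C(m,k) · #E(K_m)` (the Valiant matrix of the clique polynomial) computes CLIQUE. -/
theorem not_withoutGRankDim : ¬ WithoutGRankDim := by
  rintro ⟨δ, hδ0, -, h⟩
  refine not_eventually_of_forall_ge 2 (fun m hm hP => ?_) (h 0)
  obtain ⟨C, hC, hs, hc⟩ := exists_oneGRankGate_computes_cliqueFn m (kOf δ m) (two_le_kOf hδ0 hm)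
  refine hP C (hC.mono fun g hg => Or.inr (Or.inr ⟨_, hg⟩)) (hs.trans ?_) hc
  simp

/-- The crux with an arbitrary dimension budget `D m c` for the wide gates in place of `m ^ c`. -/
def BlindDim (D : ℕ → ℕ → ℕ) (δ : ℝ) : Prop :=
  ∀ c : ℕ, ∀ᶠ m : ℕ in atTop, ∀ C : Circuit ((⊤ : SimpleGraph (Fin m)).edgeSet),
    C.IsOver (basis (D m c)) → C.size ≤ m ^ c → ¬ C.Computes (cliqueFn m (kOf δ m))

theorem blindAt_iff_blindDim (δ : ℝ) : BlindAt δ ↔ BlindDim (fun m c => m ^ c) δ := Iff.rfl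

/-- **Quantitative form of the dimension hypothesis**: as soon as the budget reaches
`1 + C(m,k) · #E(K_m)` frequently (at some `c`), blindness fails — one gate suffices. -/
theorem not_blindDim_of_frequently_le {D : ℕ → ℕ → ℕ} {δ : ℝ} (hδ : 0 < δ) (c : ℕ)
    (h : ∃ᶠ m in atTop, 1 + m.choose (kOf δ m) * CliqueLPGate.nE m ≤ D m c) : ¬ BlindDim D δ := by
  intro hB
  obtain ⟨m, ⟨hD, h2⟩, hm⟩ := ((h.and_eventually (eventually_ge_atTop 2)).and_eventually (hB c)).exists
  obtain ⟨C, hC, hs, hc⟩ := exists_oneGRankGate_computes_cliqueFn m (kOf δ m) (two_le_kOf hδ h2)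
  refine hm C (hC.mono fun g hg => isGRankGate_subset_basis (IsGRankGate.mono hg hD)) (hs.trans ?_) hc
  simpa using Nat.one_le_pow c m (by omega)

/-- **The dimension threshold is at most `m^{k+3}`, `k = ⌈m^δ⌉₊`**: with that budget (i.e.
`2^{O(m^δ log m)}`, subexponential in the number of inputs) ONE gate computes CLIQUE, at every `c`. -/
theorem not_blindDim_pow_kOf {δ : ℝ} (hδ : 0 < δ) : ¬ BlindDim (fun m _ => m ^ (kOf δ m + 3)) δ :=
  not_blindDim_of_frequently_le hδ 0 (Filter.Eventually.frequently
    (by filter_upwards [eventually_ge_atTop 2] with m hm using one_add_choose_mul_nE_le hm _))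

/-- The crux at a CONSTANT clique size `k₀` (instead of `⌈m^δ⌉₊ → ∞`). -/
def BlindConstK (k₀ : ℕ) : Prop :=
  ∀ c : ℕ, ∀ᶠ m : ℕ in atTop, ∀ C : Circuit ((⊤ : SimpleGraph (Fin m)).edgeSet),
    C.IsOver (basis (m ^ c)) → C.size ≤ m ^ c → ¬ C.Computes (cliqueFn m k₀)

/-- **Any proof must use `k → ∞`**: for constant `k₀` one GRANK gate of dimension `≤ m^{k₀+3}`
(or, for `k₀ ≤ 1`, a constant gate) computes `CLIQUE(m, k₀)`. -/
theorem not_blindConstK (k₀ : ℕ) : ¬ BlindConstK k₀ := by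
  intro h
  by_cases hk : k₀ ≤ 1
  · refine not_eventually_of_forall_ge 1 (fun m hm hP => ?_) (h 0)
    refine hP (Circuit.const _ true) (const_isOver_basis _ true _) (by simp) fun x => ?_
    rw [Circuit.eval_const, cliqueFn_eq_true_of_le_one hk hm]
  · refine not_eventually_of_forall_ge 2 (fun m hm hP => ?_) (h (k₀ + 3))
    obtain ⟨C, hC, hs, hc⟩ := exists_oneGRankGate_computes_cliqueFn m k₀ (by omega)
    refine hP C (hC.mono fun g hg => isGRankGate_subset_basis
      (IsGRankGate.mono hg (one_add_choose_mul_nE_le hm k₀))) (hs.trans ?_) hc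
    exact Nat.one_le_pow _ _ (by omega)

/-- The crux with a threshold `m₀` UNIFORM in `c` (`∃ m₀ ∀ c` instead of `∀ c ∃ m₀`). -/
def UniformThreshold : Prop :=
  ∃ δ : ℝ, 0 < δ ∧ δ < 1 / 2 ∧ ∃ m₀ : ℕ, ∀ c : ℕ, ∀ m ≥ m₀,
    ∀ C : Circuit ((⊤ : SimpleGraph (Fin m)).edgeSet),
      C.IsOver (basis (m ^ c)) → C.size ≤ m ^ c → ¬ C.Computes (cliqueFn m (kOf δ m))

/-- **The quantifier order `∀ c, ∀ᶠ m` is load-bearing**: for a fixed `m` the exponent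
`c = ⌈m^δ⌉₊ + 3` already pays for the one-gate circuit. -/
theorem not_uniformThreshold : ¬ UniformThreshold := by
  rintro ⟨δ, hδ0, -, m₀, h⟩
  set m := max m₀ 2 with hm
  have hm2 : 2 ≤ m := le_max_right _ _
  obtain ⟨C, hC, hs, hc⟩ := exists_oneGRankGate_computes_cliqueFn m (kOf δ m) (two_le_kOf hδ0 hm2)
  refine h (kOf δ m + 3) m (le_max_left _ _) C (hC.mono fun g hg => isGRankGate_subset_basis
    (IsGRankGate.mono hg (one_add_choose_mul_nE_le hm2 _))) (hs.trans ?_) hc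
  exact Nat.one_le_pow _ _ (by omega)

/-- **The window for `δ`, lower end**: `BlindAt δ` forces `δ > 0` (for `δ ≤ 0`, `k ≤ 1` and
CLIQUE is the constant `1`, a PERM gate on `0` points). -/
theorem blindAt_pos {δ : ℝ} (h : BlindAt δ) : 0 < δ := by
  by_contra hδ
  push Not at hδ
  refine not_eventually_of_forall_ge 1 (fun m hm hP => ?_) (h 0)
  refine hP (Circuit.const _ true) (const_isOver_basis _ true _) (by simp) fun x => ?_
  rw [Circuit.eval_const, cliqueFn_eq_true_of_le_one (kOf_le_one hδ hm) hm]

/-- **The window for `δ`, upper end**: `BlindAt δ` forces `δ ≤ 1` (for `δ > 1`, `k > m` and CLIQUE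
is the constant `0`, a GRANK gate of dimension `0`). So the inner statement can only hold for
`δ ∈ (0, 1]`; the crux asks for `δ ∈ (0, 1/2)` (the Alon–Boppana regime `k ≤ √m`). -/
theorem blindAt_le_one {δ : ℝ} (h : BlindAt δ) : δ ≤ 1 := by
  by_contra hδ
  push Not at hδ
  refine not_eventually_of_forall_ge 2 (fun m hm hP => ?_) (h 0)
  refine hP (Circuit.const _ false) (const_isOver_basis _ false _) (by simp) fun x => ?_
  rw [Circuit.eval_const, cliqueFn_eq_false_of_lt (lt_kOf hδ hm)]

theorem blind_window {δ : ℝ} (h : BlindAt δ) : 0 < δ ∧ δ ≤ 1 := ⟨blindAt_pos h, blindAt_le_one h⟩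

end LoadBearing

/-! ### (b) REDUCTION and HARDNESS CERTIFICATE — what a proof of the crux must also prove -/

section Hardness

/-- **One wide gate kills the crux.** If for every `δ ∈ (0, 1/2)` some `Lin (m^c)` gate, wired
directly to the inputs, computes `CLIQUE(m, ⌈m^δ⌉₊)` for infinitely many `m`, the crux is false.
(For PERM and tame GRANK such a gate would put CLIQUE in P/poly; the only vector without that
consequence is a GRANK gate with wild field constants.) -/
theorem not_blind_of_oneLinGate
    (h : ∀ δ : ℝ, 0 < δ → δ < 1 / 2 → ∃ c : ℕ, ∃ᶠ m in atTop, ∃ g ∈ Lin (m ^ c),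
      ∃ w : Fin g.1 → (⊤ : SimpleGraph (Fin m)).edgeSet,
        ∀ x, g.2 (fun a => x (w a)) = cliqueFn m (kOf δ m) x) : ¬ Blind := by
  rintro ⟨δ, hδ0, hδ1, hB⟩
  obtain ⟨c, hc⟩ := h δ hδ0 hδ1
  refine not_blindAt_of_frequently c ?_ hB
  refine (hc.and_eventually (eventually_ge_atTop 1)).mono ?_
  rintro m ⟨⟨g, hg, w, hw⟩, hm⟩
  obtain ⟨C, hC, hs, he⟩ := (CktSize.gate (B := Lin (m ^ c)) g hg w).toCircuit
  refine ⟨C, hC.mono Set.subset_union_right, hs.trans (Nat.one_le_pow _ _ (by omega)), fun x => ?_⟩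
  rw [he x, hw x]

/-- **Support-robust Valiant certificate.** `BlindAt δ` implies: over EVERY field `F`, eventually
in `m`, NO polynomial in the edge variables whose monotone shadow is `CLIQUE(m, ⌈m^δ⌉₊)` — the
clique polynomial, or any element of the `k`-clique monomial ideal touching every `k`-clique, with
arbitrary (wild) coefficients — has an affine determinantal representation of size `≤ m^c`. -/
theorem shadow_hasDetRepr_lowerBound_of_blindAt {δ : ℝ} (h : BlindAt δ) (F : Type) [Field F]
    (c : ℕ) : ∀ᶠ m : ℕ in atTop, ∀ d ≤ m ^ c, ∀ P : MvPolynomial (Fin (CliqueLPGate.nE m)) F,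
      (∀ x, (∃ s ∈ P.support, ∀ i ∈ s.support, x ((CliqueLPGate.eE m).symm i) = true) ↔
        cliqueFn m (kOf δ m) x = true) →
      ¬ Literature.Computability.AlgebraicComplexity.HasDetRepr P d := by
  filter_upwards [h c, eventually_ge_atTop 1] with m hm h1 d hd P hP hrepr
  obtain ⟨C, hC, hs, hc⟩ := exists_oneGRankGate_of_shadow hP hrepr
  exact hm C (hC.mono fun g hg => isGRankGate_subset_basis (IsGRankGate.mono hg hd))
    (hs.trans (Nat.one_le_pow _ _ h1)) hc

/-- **Valiant certificate (determinantal complexity of the clique polynomial).** `BlindAt δ`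
(`δ > 0`) implies `dc(CL_{m,⌈m^δ⌉₊}) > m^c` eventually, for every `c`, over every field. -/
theorem hasDetRepr_cliquePoly_lowerBound_of_blindAt {δ : ℝ} (h : BlindAt δ) (hδ : 0 < δ)
    (F : Type) [Field F] (c : ℕ) :
    ∀ᶠ m : ℕ in atTop, ∀ d ≤ m ^ c,
      ¬ Literature.Computability.AlgebraicComplexity.HasDetRepr (cliquePoly m F (kOf δ m)) d := by
  filter_upwards [shadow_hasDetRepr_lowerBound_of_blindAt h F c, eventually_ge_atTop 2]
    with m hm h2 d hd
  exact hm d hd _ (shadow_cliquePoly_iff (two_le_kOf hδ h2))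

/-- The same in terms of `determinantalComplexity`: `m ^ c < dc (CL_{m, ⌈m^δ⌉₊})` eventually. -/
theorem determinantalComplexity_cliquePoly_of_blindAt {δ : ℝ} (h : BlindAt δ) (hδ : 0 < δ)
    (F : Type) [Field F] (c : ℕ) :
    ∀ᶠ m : ℕ in atTop, m ^ c <
      Literature.Computability.AlgebraicComplexity.determinantalComplexity (cliquePoly m F (kOf δ m)) := by
  filter_upwards [hasDetRepr_cliquePoly_lowerBound_of_blindAt h hδ F c] with m hm
  by_contra hle
  push Not at hle
  exact hm _ hle
    (Literature.Computability.AlgebraicComplexity.hasDetRepr_determinantalComplexity_holds _)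

/-- **HEADLINE.** The crux AS TYPED implies a superpolynomial lower bound for the determinantal
complexity of the clique polynomials `CL_{m, ⌈m^δ⌉₊}` over EVERY field (a VNP ⊄ VBP-type statement,
Valiant 1979): any proof of `LinAlgGateBlind` proves this much algebraic complexity. -/
theorem dc_cliquePoly_superpolynomial_of_linAlgGateBlind
    (h : Summit.PneNP.PneNP.Theses.ConvexRankGates.LinAlgGateBlind) :
    ∃ δ : ℝ, 0 < δ ∧ δ < 1 / 2 ∧ ∀ (F : Type) [Field F] (c : ℕ), ∀ᶠ m : ℕ in atTop,
      ∀ d ≤ m ^ c,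
        ¬ Literature.Computability.AlgebraicComplexity.HasDetRepr (cliquePoly m F ⌈(m : ℝ) ^ δ⌉₊) d := by
  obtain ⟨δ, hδ0, hδ1, hB⟩ := linAlgGateBlind_iff.1 h
  exact ⟨δ, hδ0, hδ1, fun F _ c => hasDetRepr_cliquePoly_lowerBound_of_blindAt hB hδ0 F c⟩

end Hardness


/-! ### (a') PERM without the dimension bound: ONE permutation gate computes CLIQUE
(the `A–B` connectivity gadget: a private path per `k`-set, switched on edge by edge) -/

section PermGadget

open Equiv

/-- PERM gates presented on an arbitrary finite point type transport to `IsPermGate`. -/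
theorem isPermGate_of_fintype {P : Type} [Fintype P] [DecidableEq P] {s n : ℕ}
    (hs : Fintype.card P ≤ s) (σ : Fin n → Perm P) (τ : Perm P) (f : (Fin n → Bool) → Bool)
    (hf : ∀ v, f v = true ↔ τ ∈ Subgroup.closure (σ '' {i | v i = true})) :
    IsPermGate s ⟨n, f⟩ := by
  let e := Fintype.equivFin P
  let φ : Perm P ≃* Perm (Fin (Fintype.card P)) := e.permCongrHom
  refine ⟨Fintype.card P, hs, fun i => φ (σ i), φ τ, fun v => ?_⟩
  show f v = true ↔ _
  have himg : (fun i => φ (σ i)) '' {i | v i = true} = φ.toMonoidHom '' (σ '' {i | v i = true}) := by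
    rw [Set.image_image]; rfl
  rw [hf v, himg, ← MonoidHom.map_closure, Subgroup.mem_map_equiv, MulEquiv.symm_apply_apply]

/-- The subgroup of permutations preserving a set (both ways). -/
def setStab {P : Type*} (S : Set P) : Subgroup (Perm P) where
  carrier := {g | ∀ p, g p ∈ S ↔ p ∈ S}
  mul_mem' {g h} hg hh p := by rw [Perm.mul_apply, hg, hh]
  one_mem' p := by simp
  inv_mem' {g} hg p := by
    have := hg (g⁻¹ p)
    have h1 : g (g⁻¹ p) = p := Equiv.apply_symm_apply g p
    rw [h1] at this
    exact this.symm

theorem swap_mem_setStab {P : Type*} [DecidableEq P] {S : Set P} {u v : P} (h : u ∈ S ↔ v ∈ S) :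
    swap u v ∈ setStab S := by
  intro p
  by_cases hu : p = u
  · subst hu; rw [swap_apply_left]; exact h.symm
  by_cases hv : p = v
  · subst hv; rw [swap_apply_right]; exact h
  rw [swap_apply_of_ne_of_ne hu hv]

variable (m k : ℕ)

/-- The `k`-subsets of `Fin m`. -/
abbrev KS : Type := CliqueLPGate.KSub m k

/-- Uniform path length `N₀ = #E(K_m)` (positions beyond the live edges of `T` re-read edge `0`). -/
noncomputable abbrev N₀ : ℕ := CliqueLPGate.nE m

/-- Points of the gadget: `A = inl false`, `B = inl true`, and private path nodes `(T, i)`,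
`i < N₀ - 1` (standing for node `i + 1` of the path of `T`). -/
abbrev Pt : Type := Bool ⊕ (KS m k × Fin (N₀ m - 1))

variable {m k}

/-- Node `i` of the path of `T`: `A` for `i = 0`, private for `0 < i < N₀`, `B` for `i ≥ N₀`. -/
noncomputable def node (T : KS m k) (i : ℕ) : Pt m k :=
  if h0 : i = 0 then Sum.inl false
  else if h : i < N₀ m then Sum.inr (T, ⟨i - 1, by omega⟩) else Sum.inl true

theorem node_zero (T : KS m k) : node T 0 = Sum.inl false := by simp [node]

theorem node_N₀ (T : KS m k) {i : ℕ} (hi : N₀ m ≤ i) (h0 : i ≠ 0) : node T i = Sum.inl true := by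
  simp [node, h0, not_lt.2 hi]

theorem node_mid (T : KS m k) {i : ℕ} (h0 : 0 < i) (hi : i < N₀ m) :
    node T i = Sum.inr (T, ⟨i - 1, by omega⟩) := by
  simp [node, Nat.pos_iff_ne_zero.1 h0, hi]

theorem node_ne_A (T : KS m k) {i : ℕ} (h0 : 0 < i) : node T i ≠ Sum.inl false := by
  by_cases hi : i < N₀ m
  · rw [node_mid T h0 hi]; simp
  · rw [node_N₀ T (not_lt.1 hi) (by omega)]; simp

theorem node_eq_inr_iff (T T' : KS m k) {i : ℕ} (h0 : 0 < i) (j : Fin (N₀ m - 1)) :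
    node T i = Sum.inr (T', j) ↔ T = T' ∧ i = j + 1 := by
  by_cases hi : i < N₀ m
  · rw [node_mid T h0 hi, Sum.inr.injEq, Prod.mk.injEq]
    constructor
    · rintro ⟨rfl, h⟩
      refine ⟨rfl, ?_⟩
      have := congrArg Fin.val h
      simp at this
      omega
    · rintro ⟨rfl, h⟩
      refine ⟨rfl, Fin.ext ?_⟩
      simp; omega
  · rw [node_N₀ T (not_lt.1 hi) (by omega)]
    simp only [reduceCtorEq, false_iff, not_and]
    rintro rfl
    have := j.isLt
    omega

/-- The live edges of `T`, enumerated. -/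
noncomputable def liveEnum (T : KS m k) (j : Fin (liveIdx m T.1).card) : Fin (CliqueLPGate.nE m) :=
  ((liveIdx m T.1).equivFin.symm j : liveIdx m T.1)

theorem liveEnum_mem (T : KS m k) (j : Fin (liveIdx m T.1).card) : liveEnum T j ∈ liveIdx m T.1 :=
  ((liveIdx m T.1).equivFin.symm j).2

theorem liveIdx_nonempty (hk : 2 ≤ k) (T : KS m k) : 0 < (liveIdx m T.1).card := by
  obtain ⟨u, hu, v, hv, huv⟩ := Finset.one_lt_card.1 (by have := T.2; omega : 1 < T.1.card)
  have he : s(u, v) ∈ (⊤ : SimpleGraph (Fin m)).edgeSet := (SimpleGraph.mem_edgeSet _).2 huv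
  refine Finset.card_pos.2 ⟨CliqueLPGate.eE m ⟨s(u, v), he⟩, ?_⟩
  simp only [liveIdx, Finset.mem_filter, Finset.mem_univ, true_and, Equiv.symm_apply_apply]
  exact (isLive_mk he).2 ⟨hu, hv⟩

theorem card_liveIdx_le (T : Finset (Fin m)) : (liveIdx m T).card ≤ N₀ m :=
  (Finset.card_filter_le _ _).trans (by simp)

/-- The edge read at position `j < N₀` of the path of `T`: the `j`-th live edge, or live edge `0`. -/
noncomputable def edgeAt (hk : 2 ≤ k) (T : KS m k) (j : ℕ) : (⊤ : SimpleGraph (Fin m)).edgeSet :=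
  (CliqueLPGate.eE m).symm (liveEnum T
    (if h : j < (liveIdx m T.1).card then ⟨j, h⟩ else ⟨0, liveIdx_nonempty hk T⟩))

theorem isLive_edgeAt (hk : 2 ≤ k) (T : KS m k) (j : ℕ) : IsLive T.1 (edgeAt hk T j) := by
  have := liveEnum_mem T (if h : j < (liveIdx m T.1).card then ⟨j, h⟩ else ⟨0, liveIdx_nonempty hk T⟩)
  simp only [liveIdx, Finset.mem_filter, Finset.mem_univ, true_and] at this
  exact this

/-- All positions of the path of `T` are on iff all live edges of `T` are on (iff `T` is a clique). -/
theorem forall_edgeAt_iff (hk : 2 ≤ k) (T : KS m k) (x : (⊤ : SimpleGraph (Fin m)).edgeSet → Bool) :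
    (∀ j < N₀ m, x (edgeAt hk T j) = true) ↔ ∀ e, IsLive T.1 e → x e = true := by
  constructor
  · intro h e he
    set i : liveIdx m T.1 := ⟨CliqueLPGate.eE m e, by
      simp only [liveIdx, Finset.mem_filter, Finset.mem_univ, true_and, Equiv.symm_apply_apply]
      exact he⟩ with hi
    set j := (liveIdx m T.1).equivFin i with hj
    have hjlt : (j : ℕ) < (liveIdx m T.1).card := j.isLt
    have := h j (lt_of_lt_of_le hjlt (card_liveIdx_le T.1))
    rw [edgeAt, dif_pos hjlt, liveEnum, Fin.eta, hj, Equiv.symm_apply_apply] at this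
    simpa [hi] using this
  · intro h j _
    exact h _ (isLive_edgeAt hk T j)

/-- Generator at position `j`: the transposition of nodes `j` and `j + 1` of the path of `T`. -/
noncomputable def gen (T : KS m k) (j : ℕ) : Perm (Pt m k) := swap (node T j) (node T (j + 1))

/-- Going up the path: if all positions `< i` of `T` are on then `swap A (node T i)` is generated
(`1 ≤ i ≤ N₀`). -/
theorem swap_A_node_mem {H : Subgroup (Perm (Pt m k))} (T : KS m k) {i : ℕ} (h1 : 1 ≤ i)
    (hgen : ∀ j < i, gen T j ∈ H) : swap (Sum.inl false) (node T i) ∈ H := by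
  induction i with
  | zero => omega
  | succ i ih =>
    rcases Nat.eq_zero_or_pos i with rfl | hi
    · have := hgen 0 (by omega)
      rwa [gen, node_zero] at this
    · have hprev := ih hi fun j hj => hgen j (by omega)
      have hg := hgen i (by omega)
      rw [gen] at hg
      have key := swap_mul_swap_mul_swap (x := (Sum.inl false : Pt m k)) (y := node T i)
        (z := node T (i + 1)) (node_ne_A T hi).symm (node_ne_A T (by omega)).symm
      rw [swap_comm (node T (i + 1))] at key
      rw [← key]
      exact H.mul_mem (H.mul_mem hg hprev) hg

variable (hk : 2 ≤ k)

/-- **The connectivity gadget is exact**: `swap A B` lies in the subgroup generated by the switched-on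
path transpositions iff some `k`-set has all its positions on. -/
theorem swap_AB_mem_closure_iff (x : (⊤ : SimpleGraph (Fin m)).edgeSet → Bool) :
    swap (Sum.inl false) (Sum.inl true) ∈ Subgroup.closure
        {g | ∃ (T : KS m k) (j : ℕ), j < N₀ m ∧ x (edgeAt hk T j) = true ∧ g = gen T j} ↔
      ∃ T : KS m k, ∀ j < N₀ m, x (edgeAt hk T j) = true := by
  constructor
  · intro hmem
    by_contra hno
    push Not at hno
    -- the invariant set: `A` and the private nodes reachable along an all-on prefix
    let S : Set (Pt m k) := {p | p = Sum.inl false ∨ ∃ (T : KS m k) (i : ℕ), 0 < i ∧ i < N₀ m ∧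
      p = node T i ∧ ∀ j < i, x (edgeAt hk T j) = true}
    have hB : (Sum.inl true : Pt m k) ∉ S := by
      rintro (h | ⟨T, i, h0, hi, h, -⟩)
      · simp at h
      · rw [node_mid T h0 hi] at h; simp at h
    have hA : (Sum.inl false : Pt m k) ∈ S := Or.inl rfl
    -- membership of private nodes in `S`
    have hmemS : ∀ (T : KS m k) (i : ℕ), 0 < i → (node T i ∈ S ↔
        i < N₀ m ∧ ∀ j < i, x (edgeAt hk T j) = true) := by
      intro T i h0
      constructor
      · rintro (h | ⟨T', i', h0', hi', h, hall⟩)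
        · exact absurd h (node_ne_A T h0)
        · rw [node_mid T' h0' hi', node_eq_inr_iff T T' h0] at h
          obtain ⟨rfl, hi⟩ := h
          have : i = i' := by simp at hi; omega
          subst this
          exact ⟨hi', hall⟩
      · rintro ⟨hi, hall⟩
        exact Or.inr ⟨T, i, h0, hi, rfl, hall⟩
    -- every switched-on generator preserves `S`
    have hgen : ∀ g ∈ {g | ∃ (T : KS m k) (j : ℕ), j < N₀ m ∧ x (edgeAt hk T j) = true ∧ g = gen T j},
        g ∈ setStab S := by
      rintro g ⟨T, j, hj, hxj, rfl⟩
      apply swap_mem_setStab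
      constructor
      · intro hjS
        -- all positions `< j` are on (trivial for `j = 0`), and position `j` is on
        have hall : ∀ j' < j + 1, x (edgeAt hk T j') = true := by
          intro j' hj'
          rcases Nat.lt_succ_iff_lt_or_eq.1 hj' with hlt | rfl
          · rcases Nat.eq_zero_or_pos j with rfl | h0
            · omega
            · exact ((hmemS T j h0).1 hjS).2 j' hlt
          · exact hxj
        by_cases hj1 : j + 1 < N₀ m
        · exact (hmemS T (j + 1) (by omega)).2 ⟨hj1, hall⟩
        · obtain ⟨j', hj', hne⟩ := hno T
          exact absurd (hall j' (by omega)) hne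
      · intro hj1S
        obtain ⟨hj1, hall⟩ := (hmemS T (j + 1) (by omega)).1 hj1S
        rcases Nat.eq_zero_or_pos j with rfl | h0
        · rw [node_zero]; exact hA
        · exact (hmemS T j h0).2 ⟨by omega, fun j' hj' => hall j' (by omega)⟩
    have hle := (Subgroup.closure_le (setStab S)).2 hgen
    have := (hle hmem) (Sum.inl false)
    rw [swap_apply_left] at this
    exact hB (this.2 hA)
  · rintro ⟨T, hT⟩
    have hN : 1 ≤ N₀ m := (liveIdx_nonempty hk T).trans_le (card_liveIdx_le T.1)
    have h := swap_A_node_mem (H := Subgroup.closure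
      {g | ∃ (T : KS m k) (j : ℕ), j < N₀ m ∧ x (edgeAt hk T j) = true ∧ g = gen T j}) T hN
      (fun j hj => Subgroup.subset_closure ⟨T, j, hj, hT j hj, rfl⟩)
    rwa [node_N₀ T le_rfl (by omega)] at h


/-- `CLIQUE(m,k)(x) = 1` iff some `k`-set has all the positions of its path on. -/
theorem cliqueFn_eq_true_iff_exists_edgeAt (x : (⊤ : SimpleGraph (Fin m)).edgeSet → Bool) :
    cliqueFn m k x = true ↔ ∃ T : KS m k, ∀ j < N₀ m, x (edgeAt hk T j) = true := by
  rw [cliqueFn_eq_true_iff_exists]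
  constructor
  · rintro ⟨T, hT, hx⟩
    exact ⟨⟨T, hT⟩, (forall_edgeAt_iff hk ⟨T, hT⟩ x).2 hx⟩
  · rintro ⟨T, hT⟩
    exact ⟨T.1, T.2, (forall_edgeAt_iff hk T x).1 hT⟩

variable (m k)

/-- The argument positions of the gadget gate: (`k`-set, path position). -/
abbrev Arg : Type := KS m k × Fin (N₀ m)

variable {m k}

/-- The generator attached to argument position `a = (T, j)`. -/
noncomputable def genAt (a : Fin (Fintype.card (Arg m k))) : Perm (Pt m k) :=
  gen ((Fintype.equivFin (Arg m k)).symm a).1 ((Fintype.equivFin (Arg m k)).symm a).2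

open scoped Classical in
/-- The gadget as a gate function on `Fin #Arg` inputs. -/
noncomputable def permCliqueGate : GateFn :=
  ⟨Fintype.card (Arg m k), fun v => decide (swap (Sum.inl false) (Sum.inl true) ∈
    Subgroup.closure (genAt (m := m) (k := k) '' {a | v a = true}))⟩

/-- The wiring of the gadget gate: position `a = (T, j)` reads `edgeAt T j`. -/
noncomputable def permCliqueWire (a : Fin (Fintype.card (Arg m k))) : (⊤ : SimpleGraph (Fin m)).edgeSet :=
  edgeAt hk ((Fintype.equivFin (Arg m k)).symm a).1 ((Fintype.equivFin (Arg m k)).symm a).2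

theorem permCliqueGate_isPermGate : IsPermGate (Fintype.card (Pt m k)) (permCliqueGate (m := m) (k := k)) := by
  classical
  exact isPermGate_of_fintype le_rfl _ _ _ fun _ => decide_eq_true_iff

/-- The switched-on generators of the wired gate are the switched-on path transpositions. -/
theorem image_genAt_eq (x : (⊤ : SimpleGraph (Fin m)).edgeSet → Bool) :
    genAt (m := m) (k := k) '' {a | x (permCliqueWire hk a) = true} =
      {g | ∃ (T : KS m k) (j : ℕ), j < N₀ m ∧ x (edgeAt hk T j) = true ∧ g = gen T j} := by
  ext g
  simp only [Set.mem_image, Set.mem_setOf_eq, permCliqueWire, genAt]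
  constructor
  · rintro ⟨a, ha, rfl⟩
    exact ⟨_, _, ((Fintype.equivFin (Arg m k)).symm a).2.isLt, ha, rfl⟩
  · rintro ⟨T, j, hj, hx, rfl⟩
    refine ⟨Fintype.equivFin (Arg m k) (T, ⟨j, hj⟩), ?_, ?_⟩ <;> simp [hx]

/-- **The gadget gate, wired to the edges, computes `CLIQUE(m, k)`** (`k ≥ 2`). -/
theorem permCliqueGate_apply (x : (⊤ : SimpleGraph (Fin m)).edgeSet → Bool) :
    (permCliqueGate (m := m) (k := k)).2 (fun a => x (permCliqueWire hk a)) = cliqueFn m k x := by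
  classical
  apply Bool.eq_iff_iff.2
  rw [cliqueFn_eq_true_iff_exists_edgeAt hk, ← swap_AB_mem_closure_iff hk x, ← image_genAt_eq hk x]
  exact decide_eq_true_iff

variable (m k) in
/-- **`CLIQUE(m, k)` is ONE PERM gate on `#Pt = 2 + C(m,k)·(#E(K_m) - 1)` points** (`k ≥ 2`). -/
theorem exists_onePermGate_computes_cliqueFn (hk : 2 ≤ k) :
    ∃ C : Circuit ((⊤ : SimpleGraph (Fin m)).edgeSet),
      C.IsOver {g | IsPermGate (Fintype.card (Pt m k)) g} ∧ C.size ≤ 1 ∧ C.Computes (cliqueFn m k) := by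
  obtain ⟨C, hC, hs, he⟩ := (CktSize.gate (B := {g | IsPermGate (Fintype.card (Pt m k)) g})
    permCliqueGate permCliqueGate_isPermGate (permCliqueWire hk)).toCircuit
  exact ⟨C, hC, hs, fun x => by rw [he x]; exact permCliqueGate_apply hk x⟩

variable (m k) in
/-- Point count of the gadget. -/
theorem card_Pt : Fintype.card (Pt m k) = 2 + m.choose k * (CliqueLPGate.nE m - 1) := by
  simp only [Pt, Fintype.card_sum, Fintype.card_bool, Fintype.card_prod, Fintype.card_fin]
  rw [show Fintype.card (KS m k) = m.choose k from CliqueLPGate.nK_eq m k]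

variable (m k) in
theorem card_Pt_le (hm : 2 ≤ m) : Fintype.card (Pt m k) ≤ m ^ (k + 3) := by
  rw [card_Pt]
  have : 2 + m.choose k * (CliqueLPGate.nE m - 1) ≤ 1 + (1 + m.choose k * CliqueLPGate.nE m) := by
    have := Nat.mul_le_mul_left (m.choose k) (Nat.sub_le (CliqueLPGate.nE m) 1)
    omega
  refine this.trans ?_
  have h1 := one_add_choose_mul_nE_le hm k
  -- `1 + m^{k+3}`-slack: redo the estimate with room
  have h2 : 1 + (1 + m.choose k * CliqueLPGate.nE m) ≤ m ^ (k + 2) + m ^ (k + 2) := by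
    have : 1 ≤ m ^ (k + 2) := Nat.one_le_pow _ _ (by omega)
    have : m.choose k * CliqueLPGate.nE m ≤ m ^ k * m ^ 2 :=
      Nat.mul_le_mul (Nat.choose_le_pow m k) (CliqueLPGate.nE_le m)
    have : m ^ k * m ^ 2 = m ^ (k + 2) := by ring
    have : 2 ≤ m ^ (k + 2) := le_trans hm (by
      calc m = m ^ 1 := (pow_one m).symm
        _ ≤ m ^ (k + 2) := Nat.pow_le_pow_right (by omega) (by omega))
    omega
  calc 1 + (1 + m.choose k * CliqueLPGate.nE m) ≤ m ^ (k + 2) + m ^ (k + 2) := h2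
    _ = 2 * m ^ (k + 2) := by ring
    _ ≤ m * m ^ (k + 2) := Nat.mul_le_mul_right _ hm
    _ = m ^ (k + 3) := by ring

end PermGadget

section PermLoadBearing

/-- PERM gates on an unrestricted number of points. -/
def PermAnyDim (g : GateFn) : Prop := ∃ t, IsPermGate t g

/-- The basis with the point bound dropped from PERM (GRANK keeps `d ≤ s`). -/
def basisNoPermDim (s : ℕ) : Set GateFn :=
  {GateFn.and 2, GateFn.or 2} ∪ {g | PermAnyDim g ∨ IsGRankGate s g}

/-- The crux WITHOUT the bound `d ≤ m^c` on the number of points of PERM gates. -/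
def WithoutPermDim : Prop :=
  ∃ δ : ℝ, 0 < δ ∧ δ < 1 / 2 ∧ ∀ c : ℕ, ∀ᶠ m : ℕ in atTop,
    ∀ C : Circuit ((⊤ : SimpleGraph (Fin m)).edgeSet), C.IsOver (basisNoPermDim (m ^ c)) →
      C.size ≤ m ^ c → ¬ C.Computes (cliqueFn m (kOf δ m))

/-- **Any proof must use the point bound of the PERM gates**: ONE permutation gate on
`2 + C(m,k)·(#E(K_m) - 1)` points (transposition `(A B)` ∈ ⟨on path transpositions⟩ iff some
`k`-set's private `A–B` path is entirely on) computes CLIQUE. -/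
theorem not_withoutPermDim : ¬ WithoutPermDim := by
  rintro ⟨δ, hδ0, -, h⟩
  refine not_eventually_of_forall_ge 2 (fun m hm hP => ?_) (h 0)
  obtain ⟨C, hC, hs, hc⟩ := exists_onePermGate_computes_cliqueFn m (kOf δ m) (two_le_kOf hδ0 hm)
  refine hP C (hC.mono fun g hg => Or.inr (Or.inl ⟨_, hg⟩)) (hs.trans ?_) hc
  simp

/-- Blindness over the PERM-ONLY basis `{∧₂, ∨₂} ∪ PERM_{D m c}` with point budget `D`. -/
def BlindPermOnly (D : ℕ → ℕ → ℕ) (δ : ℝ) : Prop :=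
  ∀ c : ℕ, ∀ᶠ m : ℕ in atTop, ∀ C : Circuit ((⊤ : SimpleGraph (Fin m)).edgeSet),
    C.IsOver ({GateFn.and 2, GateFn.or 2} ∪ {g | IsPermGate (D m c) g}) → C.size ≤ m ^ c →
      ¬ C.Computes (cliqueFn m (kOf δ m))

/-- **PERM point threshold ≤ m^{k+3}**: even without any GRANK gate, a point budget of `m^{k+3}`
(`k = ⌈m^δ⌉₊`) lets ONE permutation gate compute CLIQUE, at every `c`. -/
theorem not_blindPermOnly_pow_kOf {δ : ℝ} (hδ : 0 < δ) :
    ¬ BlindPermOnly (fun m _ => m ^ (kOf δ m + 3)) δ := by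
  intro h
  refine not_eventually_of_forall_ge 2 (fun m hm hP => ?_) (h 0)
  obtain ⟨C, hC, hs, hc⟩ := exists_onePermGate_computes_cliqueFn m (kOf δ m) (two_le_kOf hδ hm)
  refine hP C (hC.mono fun g hg => Or.inr (IsPermGate.mono hg (card_Pt_le m _ hm))) (hs.trans ?_) hc
  simp

end PermLoadBearing


/-! ### (d) TARGETS — kills of stub / first-lemma signatures filed against this crux

No lead line is picked yet (`stuck_stubs = []`). The ideator sketch
`Cruxes/LinAlgGateBlind/IdeatorSketch3.lean` files first-lemma signatures; one of them is false as
stated (degenerate clique size), with an obvious repair. Its definitions are copied VERBATIM below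
(namespace `Sketch3Copy`) so that the refutation typechecks against the filed text. -/

namespace Sketch3Copy

open scoped BigOperators Classical
open Literature.Computability.AlgebraicComplexity MvPolynomial

noncomputable section

/-- (verbatim copy of `…Sketch3.Edge`) Edge type of `K_m`, as in the route file. -/
abbrev Edge (m : ℕ) : Type := ((⊤ : SimpleGraph (Fin m)).edgeSet)

/-- (verbatim copy of `…Sketch3.cliqueFun`) The inline clique function of the route. -/
def cliqueFun (m k : ℕ) (x : Edge m → Bool) : Bool :=
  decide (¬ (SimpleGraph.fromEdgeSet {e : Sym2 (Fin m) |
    ∃ h : e ∈ (⊤ : SimpleGraph (Fin m)).edgeSet, x ⟨e, h⟩ = true}).CliqueFree k)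

/-- (verbatim copy of `…Sketch3.cliqueCover`) The clique-cover polynomial
`CC_{m,k} = Σ_{|S|=k} Π_{e ⊆ S} x_e · Π_{e ⊄ S} (1 + z_e x_e)`. -/
def cliqueCover (m k : ℕ) (F : Type) [Field F] : MvPolynomial (Edge m ⊕ Edge m) F :=
  ∑ S ∈ (Finset.univ : Finset (Fin m)).powersetCard k,
    ∏ e : Edge m, (if (∀ v ∈ (e : Sym2 (Fin m)), v ∈ S) then X (Sum.inl e)
      else 1 + X (Sum.inr e) * X (Sum.inl e))

/-- (verbatim copy of `…Sketch3.shadow`) Monotone shadow on an edge set `E`. -/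
def shadow {m : ℕ} {ι F : Type} [Field F] (f : MvPolynomial (Edge m ⊕ ι) F)
    (E : Set (Edge m)) : Prop :=
  MvPolynomial.aeval (R := F) (S₁ := MvPolynomial (Edge m ⊕ ι) F)
    (Sum.elim (fun e => if e ∈ E then X (Sum.inl e) else 0) (fun i => X (Sum.inr i))) f ≠ 0

/-- (verbatim copy of `…Sketch3.ShadowCliqueCover`) "the shadow of `CC_{m,k}` is `CLIQUE(m,k)`". -/
def ShadowCliqueCover : Prop :=
  ∀ (m k : ℕ) (F : Type) [Field F] (x : Edge m → Bool),
    shadow (cliqueCover m k F) {e | x e = true} ↔ cliqueFun m k x = true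

end

/-- In characteristic `2` the clique-cover polynomial `CC_{2,1}` VANISHES: both `1`-subsets of
`Fin 2` contribute the same term `∏ₑ (1 + zₑ xₑ)` (no edge lies inside a singleton). -/
theorem cliqueCover_two_one_zmod2 : cliqueCover 2 1 (ZMod 2) = 0 := by
  classical
  set P₀ : MvPolynomial (Edge 2 ⊕ Edge 2) (ZMod 2) :=
    ∏ e : Edge 2, (1 + X (Sum.inr e) * X (Sum.inl e)) with hP₀
  have hterm : ∀ S ∈ (Finset.univ : Finset (Fin 2)).powersetCard 1,
      (∏ e : Edge 2, (if (∀ v ∈ (e : Sym2 (Fin 2)), v ∈ S) then X (Sum.inl e)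
        else 1 + X (Sum.inr e) * X (Sum.inl e)) : MvPolynomial (Edge 2 ⊕ Edge 2) (ZMod 2)) = P₀ := by
    intro S hS
    have hc : S.card ≤ 1 := by rw [(Finset.mem_powersetCard.1 hS).2]
    have hno : ∀ e : Edge 2, ¬ ∀ v ∈ (e : Sym2 (Fin 2)), v ∈ S :=
      edge_ind (m := 2) (P := fun e => ¬ ∀ v ∈ (e : Sym2 (Fin 2)), v ∈ S) fun u v huv hl =>
        huv (Finset.card_le_one.1 hc u (hl u (Sym2.mem_mk_left u v)) v (hl v (Sym2.mem_mk_right u v)))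
    refine Finset.prod_congr rfl fun e _ => ?_
    rw [if_neg (hno e)]
  unfold cliqueCover
  rw [Finset.sum_congr rfl hterm, Finset.sum_const, Finset.card_powersetCard, Finset.card_univ,
    Fintype.card_fin, nsmul_eq_mul]
  have h2 : ((Nat.choose 2 1 : ℕ) : MvPolynomial (Edge 2 ⊕ Edge 2) (ZMod 2)) = 0 := by
    rw [show Nat.choose 2 1 = 2 by rfl]
    exact CharP.cast_eq_zero (MvPolynomial (Edge 2 ⊕ Edge 2) (ZMod 2)) 2
  rw [h2, zero_mul]

/-- **Target kill (stub-misstated).** `ShadowCliqueCover` is FALSE as filed: at `m = 2`, `k = 1`,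
`F = 𝔽₂` the clique-cover polynomial is `0` (shadow false) while `CLIQUE(2, 1) ≡ 1`. The
mechanism (distinct `k`-sets have distinct clique monomials) needs `k ≥ 2`; for `k ≤ 1` the
polynomial degenerates to `C(m,k) · ∏ (1 + zₑxₑ)`, killed by the characteristic.
REPAIR (believed true, same proof as `shadow_cliquePoly_iff` above plus `z := 0`):
`∀ m k F [Field F] x, 2 ≤ k → (shadow (cliqueCover m k F) {e | x e} ↔ cliqueFun m k x)`;
the witness misses the repaired statement. -/
theorem not_shadowCliqueCover : ¬ ShadowCliqueCover := by
  intro h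
  have h1 := h 2 1 (ZMod 2) (fun _ => true)
  rw [cliqueCover_two_one_zmod2] at h1
  have htrue : cliqueFun 2 1 (fun _ => true) = true := by
    unfold cliqueFun
    rw [decide_eq_true_eq, SimpleGraph.cliqueFree_one, not_isEmpty_iff]
    exact ⟨0⟩
  have : shadow (0 : MvPolynomial (Edge 2 ⊕ Edge 2) (ZMod 2)) {e | (fun _ : Edge 2 => true) e = true} :=
    h1.2 htrue
  exact this (map_zero _)

end Sketch3Copy


/-! ### (b') PERM ⊇ monotone span programs: the crux implies span-program DIMENSION lower bounds
over every `𝔽_p` with `p · D ≤ m^c` (the Pitassi–Robere-type consequence of the PERM door) -/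

section SpanProgram

open Equiv

variable {D p : ℕ}

/-- Translation by `w` in the second coordinate: the regular action of `(𝔽_p)^D` on `D` disjoint
`p`-cycles. -/
def transl (w : Fin D → ZMod p) : Perm (Fin D × ZMod p) where
  toFun q := (q.1, q.2 + w q.1)
  invFun q := (q.1, q.2 - w q.1)
  left_inv q := by simp
  right_inv q := by simp

@[simp] theorem transl_apply (w : Fin D → ZMod p) (q : Fin D × ZMod p) :
    transl w q = (q.1, q.2 + w q.1) := rfl

/-- `transl` as a monoid homomorphism from `Multiplicative ((𝔽_p)^D)`. -/
def translHom : Multiplicative (Fin D → ZMod p) →* Perm (Fin D × ZMod p) where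
  toFun w := transl (Multiplicative.toAdd w)
  map_one' := by ext q <;> simp
  map_mul' a b := by
    ext q <;> simp only [toAdd_mul, transl_apply, Perm.coe_mul, Function.comp_apply, Pi.add_apply]
    ring

theorem translHom_ofAdd (w : Fin D → ZMod p) : translHom (Multiplicative.ofAdd w) = transl w := rfl

theorem translHom_injective : Function.Injective (translHom (D := D) (p := p)) := by
  intro a b h
  have key : ∀ i, Multiplicative.toAdd a i = Multiplicative.toAdd b i := fun i => by
    have := congrArg (fun g : Perm (Fin D × ZMod p) => (g (i, 0)).2) h
    simpa [translHom] using this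
  exact Multiplicative.toAdd.injective (funext key)

/-- **Generated subgroup = linear span.** The translation `transl t` lies in the subgroup generated by
the translations `transl w`, `w ∈ W`, iff `t` lies in the `𝔽_p`-span of `W`. [folklore] -/
theorem transl_mem_closure_iff (W : Set (Fin D → ZMod p)) (t : Fin D → ZMod p) :
    transl t ∈ Subgroup.closure (transl '' W) ↔ t ∈ Submodule.span (ZMod p) W := by
  have hW : transl '' W = translHom '' (Multiplicative.toAdd ⁻¹' W) := by
    ext g
    simp only [Set.mem_image, Set.mem_preimage]
    constructor
    · rintro ⟨w, hw, rfl⟩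
      exact ⟨Multiplicative.ofAdd w, by simpa using hw, rfl⟩
    · rintro ⟨a, ha, rfl⟩
      exact ⟨Multiplicative.toAdd a, ha, rfl⟩
  rw [hW, ← MonoidHom.map_closure, ← translHom_ofAdd,
    Subgroup.mem_map_iff_mem translHom_injective, ← AddSubgroup.toSubgroup_closure,
    ← Submodule.span_int_eq_addSubgroupClosure]
  change t ∈ Submodule.span ℤ W ↔ _
  rw [← Submodule.restrictScalars_span ℤ (ZMod p) (by exact ZMod.intCast_surjective) W]
  rfl

/-- **A monotone span program over `𝔽_p` of dimension `D` is ONE PERM gate on `D · p` points**: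
rows `r i ∈ (𝔽_p)^D` (one per input position, positions may repeat an input by wiring), target `t`;
the gate accepts `v` iff `t ∈ span {r i : v i = 1}`. [folklore] -/
theorem spanProgram_isPermGate [NeZero p] {R : ℕ} (r : Fin R → (Fin D → ZMod p))
    (t : Fin D → ZMod p) {s : ℕ} (hs : D * p ≤ s) :
    IsPermGate s ⟨R, fun v => @decide (t ∈ Submodule.span (ZMod p) (r '' {i | v i = true}))
      (Classical.dec _)⟩ := by
  refine isPermGate_of_fintype (P := Fin D × ZMod p) (by simpa using hs) (fun i => transl (r i))
    (transl t) _ fun v => ?_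
  rw [@decide_eq_true_iff _ (Classical.dec _), ← transl_mem_closure_iff, Set.image_image]

/-- **The span-program certificate of the crux.** `BlindAt δ` implies: for every `c` and every modulus
`p ≥ 1`, eventually in `m`, NO monotone span program over `ZMod p` of dimension `D` with
`D · p ≤ m^c`, whatever its number of rows and their edge labels, computes `CLIQUE(m, ⌈m^δ⌉₊)` —
the PERM door contains every such program as ONE gate. (Consistent with, and for suitable parameters
an instance of, the known exponential monotone span-program lower bounds; recorded as the abelian
shadow any proof of the crux re-proves.) [folklore] -/
theorem spanProgram_lowerBound_of_blindAt {δ : ℝ} (h : BlindAt δ) (c p : ℕ) [NeZero p] :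
    ∀ᶠ m : ℕ in atTop, ∀ (D R : ℕ), D * p ≤ m ^ c →
      ∀ (r : Fin R → (Fin D → ZMod p)) (t : Fin D → ZMod p)
        (w : Fin R → (⊤ : SimpleGraph (Fin m)).edgeSet),
        ¬ ∀ x, (@decide (t ∈ Submodule.span (ZMod p) (r '' {i | x (w i) = true})) (Classical.dec _) =
          cliqueFn m (kOf δ m) x) := by
  filter_upwards [h c, eventually_ge_atTop 1] with m hm h1 D R hD r t w hcomp
  obtain ⟨C, hC, hs, he⟩ := (CktSize.gate (B := {g | IsPermGate (m ^ c) g}) _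
    (spanProgram_isPermGate r t hD) w).toCircuit
  refine hm C (hC.mono isPermGate_subset_basis) (hs.trans (Nat.one_le_pow _ _ h1)) fun x => ?_
  rw [he x]
  exact hcomp x

end SpanProgram


/-! ### (e) FRONTIER — the single-gate statements a proof must contain (documented, NOT asserted)

Each `def` below is a `Prop` recorded for planners/provers; nothing in this file claims it. By
`not_blind_of_oneLinGate` the crux implies every one of them (for its `δ`); conversely they are the
natural first rungs of any proof. Status as of this file: -/

section Frontier

/-- FRONTIER 1 (abelian PERM door; KNOWN IN PRINT for suitable parameters, not in tree): no monotone
span program over `ZMod p` of dimension `D`, `D·p ≤ m^c`, computes `CLIQUE(m, ⌈m^δ⌉₊)`, eventually.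
Implied by the crux (`spanProgram_lowerBound_of_blindAt`); in print: exponential monotone
span-program lower bounds over all fields by lifting (Pitassi–Robere 2018) for CSP-SAT families that
are monotone projections of CLIQUE(m, N+1) (hub planting, ideator card
perm-door-lifted-closure-programs §(2)); Gál 2001 rank-measure characterisation. -/
def AbelianPermDoorBlind (δ : ℝ) : Prop :=
  ∀ (c p : ℕ) [NeZero p], ∀ᶠ m : ℕ in atTop, ∀ (D R : ℕ), D * p ≤ m ^ c →
    ∀ (r : Fin R → (Fin D → ZMod p)) (t : Fin D → ZMod p)
      (w : Fin R → (⊤ : SimpleGraph (Fin m)).edgeSet),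
      ¬ ∀ x, (@decide (t ∈ Submodule.span (ZMod p) (r '' {i | x (w i) = true})) (Classical.dec _) =
        cliqueFn m (kOf δ m) x)

/-- The crux implies FRONTIER 1. -/
theorem abelianPermDoorBlind_of_blindAt {δ : ℝ} (h : BlindAt δ) : AbelianPermDoorBlind δ :=
  fun c p _ => spanProgram_lowerBound_of_blindAt h c p

/-- FRONTIER 2 (nonabelian PERM door; OPEN, no technique known; true unless NP ⊆ P/poly since
membership in permutation groups is in NC — Babai–Luks–Seress 1987 / FHL 1980): no single
`PERM_{m^c}` gate wired to the inputs computes `CLIQUE(m, ⌈m^δ⌉₊)`, eventually. Ideator lines: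
invariant-module linearisation (card invariant-module-linearisation), closure programs over terms
(card perm-door-lifted-closure-programs, (O3)). -/
def NonabelianPermDoorBlind (δ : ℝ) : Prop :=
  ∀ c : ℕ, ∀ᶠ m : ℕ in atTop, ∀ g : GateFn, IsPermGate (m ^ c) g →
    ∀ w : Fin g.1 → (⊤ : SimpleGraph (Fin m)).edgeSet,
      ¬ ∀ x, g.2 (fun a => x (w a)) = cliqueFn m (kOf δ m) x

/-- The crux implies FRONTIER 2. -/
theorem nonabelianPermDoorBlind_of_blindAt {δ : ℝ} (h : BlindAt δ) : NonabelianPermDoorBlind δ := by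
  intro c
  filter_upwards [h c, eventually_ge_atTop 1] with m hm h1 g hg w hcomp
  obtain ⟨C, hC, hs, he⟩ := (CktSize.gate (B := {g | IsPermGate (m ^ c) g}) g hg w).toCircuit
  exact hm C (hC.mono isPermGate_subset_basis) (hs.trans (Nat.one_le_pow _ _ h1)) fun x => by
    rw [he x, hcomp x]

/-- FRONTIER 3 (GRANK door, every field = WILD constants allowed; OPEN and VALIANT-HARD: it implies
`dc(CL_{m,⌈m^δ⌉₊})` superpolynomial over every field by `exists_oneGRankGate_of_hasDetRepr_cliquePoly`,
and its negation needs a poly-size affine matrix whose large minors' monomial supports have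
up-closure = `k`-clique-containing edge sets — none known): no single `GRANK_{m^c}` gate wired to the
inputs computes `CLIQUE(m, ⌈m^δ⌉₊)`, eventually. The TAME sub-case (`F = ℚ`, integer entries of
bit-size `≤ m^c`) is also open but "only" NP ⊄ P/poly-hard to refute (Schwartz–Zippel with advice).
Ideator lines: determinantal shadows / read-`k` re-typing (card determinantal-shadow-valiant-kernel),
König atoms (card konig-atoms-cancellation-split). -/
def GRankDoorBlind (δ : ℝ) : Prop :=
  ∀ c : ℕ, ∀ᶠ m : ℕ in atTop, ∀ g : GateFn, IsGRankGate (m ^ c) g →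
    ∀ w : Fin g.1 → (⊤ : SimpleGraph (Fin m)).edgeSet,
      ¬ ∀ x, g.2 (fun a => x (w a)) = cliqueFn m (kOf δ m) x

/-- The crux implies FRONTIER 3. -/
theorem gRankDoorBlind_of_blindAt {δ : ℝ} (h : BlindAt δ) : GRankDoorBlind δ := by
  intro c
  filter_upwards [h c, eventually_ge_atTop 1] with m hm h1 g hg w hcomp
  obtain ⟨C, hC, hs, he⟩ := (CktSize.gate (B := {g | IsGRankGate (m ^ c) g}) g hg w).toCircuit
  exact hm C (hC.mono isGRankGate_subset_basis) (hs.trans (Nat.one_le_pow _ _ h1)) fun x => by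
    rw [he x, hcomp x]

/-- FRONTIER 3 ⇒ the Valiant-type consequence (so FRONTIER 3 alone is already Valiant-hard). -/
theorem hasDetRepr_cliquePoly_lowerBound_of_gRankDoorBlind {δ : ℝ} (h : GRankDoorBlind δ) (hδ : 0 < δ)
    (F : Type) [Field F] (c : ℕ) :
    ∀ᶠ m : ℕ in atTop, ∀ d ≤ m ^ c,
      ¬ Literature.Computability.AlgebraicComplexity.HasDetRepr (cliquePoly m F (kOf δ m)) d := by
  filter_upwards [h c, eventually_ge_atTop 2] with m hm h2 d hd hrepr
  obtain ⟨A, hA, hdet⟩ := hrepr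
  refine hm (detGate A) ((detGate_isGRankGate A).mono hd) (fun i => (CliqueLPGate.eE m).symm i) fun x => ?_
  apply Bool.eq_iff_iff.2
  rw [detGate_eq_true_iff A hA, hdet, shadow_cliquePoly_iff (two_le_kOf hδ h2)]

end Frontier


/-! ### (d') TARGETS for the PICKED line `dnf-invariant-wide-gates-see-small-cliques` (lead PICKED.md,
2026-08-16): the research stubs `stub_sgPerm` / `stub_sgGRank` assert `SGAt`, whose core is the
approximator clause `∃ 𝒜 ⊆ 𝒱(l), #lostPos ≤ ε·C(m,k) ∧ gainedNeg ≤ ε`. We copy `lostPos`/`gainedNeg`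
VERBATIM from the skeleton (`Lines/dnf-invariant-wide-gates-see-small-cliques.lean`, which is not an
importable module) and PROVE the shape any counterexample must have and a sufficient criterion. -/

namespace PickedLineCopy

open Finset Classical Razborov

open Classical in
/-- (verbatim copy of the skeleton's `lostPos`, there inside a `noncomputable section`) the `k`-sets whose
bare clique is accepted by `O` but not by the small-clique DNF `⌈𝒜⌉`. -/
noncomputable def lostPos (m k : ℕ) (O : (KEdge m → Bool) → Bool) (𝒜 : Finset (Finset (Fin m))) :
    Finset (Finset (Fin m)) :=
  (powersetCard k (univ : Finset (Fin m))).filter fun S =>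
    O (cliqueVec S) = true ∧ ¬ Accepts 𝒜 (cliqueVec S)

/-- (verbatim copy of the skeleton's `gainedNeg`) `Pr_{G ∼ G(m,q)}[O(G) = 0 ∧ ⌈𝒜⌉(G) = 1]`. -/
noncomputable def gainedNeg (m : ℕ) (q : ℝ) (O : (KEdge m → Bool) → Bool) (𝒜 : Finset (Finset (Fin m))) : ℝ :=
  prob q (fun x : KEdge m → Bool => O x = false ∧ Accepts 𝒜 x)

/-- The approximator clause of `SGAt` / `GateApprox` for one function `O`. -/
def HasApprox (m k l : ℕ) (q ε : ℝ) (O : (KEdge m → Bool) → Bool) : Prop :=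
  ∃ 𝒜 ⊆ smallSets (Fin m) l, (#(lostPos m k O 𝒜) : ℝ) ≤ ε * (m.choose k : ℝ) ∧ gainedNeg m q O 𝒜 ≤ ε

variable {m k l : ℕ} {q ε : ℝ}

/-- ESCAPE 1 (sparse acceptance): if `O` accepts at most `ε·C(m,k)` bare `k`-cliques, `𝒜 = ∅` works. -/
theorem hasApprox_of_card_accepted_le (hε : 0 ≤ ε) (O : (KEdge m → Bool) → Bool)
    (h : (#((powersetCard k (univ : Finset (Fin m))).filter fun S => O (cliqueVec S) = true) : ℝ)
      ≤ ε * (m.choose k : ℝ)) : HasApprox m k l q ε O := by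
  refine ⟨∅, empty_subset _, ?_, ?_⟩
  · have : lostPos m k O ∅ = (powersetCard k (univ : Finset (Fin m))).filter
        fun S => O (cliqueVec S) = true :=
      filter_congr fun S _ => by simp [Accepts]
    rw [this]; exact h
  · unfold gainedNeg
    rw [prob_congr (Q := fun _ => False) (fun x => by simp [Accepts]), prob_false]
    exact hε

/-- ESCAPE 2 (rare rejection): if `O` rejects at most `ε` of `G(m,q)`, `𝒜 = {∅}` (accept all) works. -/
theorem hasApprox_of_prob_reject_le (hε : 0 ≤ ε) (O : (KEdge m → Bool) → Bool)
    (h : prob q (fun x : KEdge m → Bool => O x = false) ≤ ε) : HasApprox m k l q ε O := by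
  refine ⟨{∅}, by simp, ?_, ?_⟩
  · have : lostPos m k O {∅} = ∅ := by
      refine filter_false_of_mem fun S _ => ?_
      simp [Accepts, cliquePresent_empty]
    rw [this, card_empty, Nat.cast_zero]
    positivity
  · unfold gainedNeg
    rw [prob_congr (Q := fun x => O x = false) (fun x => by simp [Accepts, cliquePresent_empty])]
    exact h

/-- The number of edges of `K_m` inside `X` is at most `C(#X, 2)`. [folklore] -/
theorem card_filter_isLive_le (X : Finset (Fin m)) :
    #((univ : Finset (KEdge m)).filter fun e => IsLive X e) ≤ (#X).choose 2 := by
  rw [← card_powersetCard 2 X]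
  refine card_le_card_of_injOn (fun e => univ.filter fun v => v ∈ (e : Sym2 (Fin m))) ?_ ?_
  · intro e he
    rw [mem_coe, mem_filter] at he
    rw [mem_coe, mem_powersetCard]
    refine ⟨fun v hv => he.2 v (mem_filter.1 hv).2, ?_⟩
    revert e
    refine edge_ind fun u v huv => ?_
    intro _
    have : (univ.filter fun w : Fin m => w ∈ s(u, v)) = {u, v} := by
      ext w; simp [Sym2.mem_iff]
    show #(univ.filter fun w : Fin m => w ∈ (s(u, v) : Sym2 (Fin m))) = 2
    rw [this, card_pair huv]
  · intro e _ e' _ h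
    apply Subtype.ext
    apply Sym2.ext
    intro w
    have := congrArg (fun s : Finset (Fin m) => w ∈ s) h
    simpa using this

/-- An atom `X` with `#X ≤ l` is present in `G(m,q)` with probability `≥ q^{C(l,2)}` (`q ∈ [0,1]`). -/
theorem pow_choose_le_prob_cliquePresent (hq0 : 0 ≤ q) (hq1 : q ≤ 1) {X : Finset (Fin m)} (hX : #X ≤ l) :
    q ^ (l.choose 2) ≤ prob q (fun x : KEdge m → Bool => CliquePresent X x) := by
  rw [prob_congr (Q := fun x : KEdge m → Bool => ∀ e ∈ (univ : Finset (KEdge m)).filter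
      (fun e => IsLive X e), x e = true) (fun x => by simp [CliquePresent]), prob_forall_eq_true]
  exact pow_le_pow_of_le_one hq0 hq1 ((card_filter_isLive_le X).trans (Nat.choose_le_choose 2 hX))

/-- **CRITERION (witness recipe for `stub_sgPerm` / `stub_sgGRank`).** If `O` accepts MORE than
`ε·C(m,k)` bare `k`-cliques and rejects `G(m,q)` with probability MORE than `1 - q^{C(l,2)} + ε`
(`≤ 1/2 + ε` in the line's regime `q^{C(l,2)} ≥ 1/2`), then NO small-clique DNF approximates `O`:
`𝒜 = ∅` loses all accepted cliques, and any `X ∈ 𝒜` is present in `G(m,q)` with probability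
`≥ q^{C(l,2)}`, so `⌈𝒜⌉` fires on `> ε` of the graphs `O` rejects. So a counterexample to SG is EXACTLY
(up to the middle range `ε < Pr[O = 0] ≤ 1 - q^{C(l,2)} + ε`) a poly-parameter PERM/GRANK term gate that is a
DETECTOR: rejects most of the dense `G(m, 1 - 4 ln m/k)` yet accepts a `> m^{-(c+1)}/4` fraction of the
bare `k`-cliques (hence, by monotonicity, every such clique PLANTED into any graph). For PERM and tame GRANK
such a detector would be a P/poly algorithm for planted `m^{1/8}`-clique detection far below the
spectral threshold `√(m/p)` (`p = 4 ln m/k`); for wild GRANK it is an unknown algebraic construction. -/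
theorem not_hasApprox_of_dense_of_reject (hq0 : 0 ≤ q) (hq1 : q ≤ 1) (O : (KEdge m → Bool) → Bool)
    (hAcc : ε * (m.choose k : ℝ) <
      #((powersetCard k (univ : Finset (Fin m))).filter fun S => O (cliqueVec S) = true))
    (hRej : 1 - q ^ (l.choose 2) + ε < prob q (fun x : KEdge m → Bool => O x = false)) :
    ¬ HasApprox m k l q ε O := by
  rintro ⟨𝒜, h𝒜, hP, hN⟩
  rcases 𝒜.eq_empty_or_nonempty with rfl | ⟨X, hX⟩
  · have : lostPos m k O ∅ = (powersetCard k (univ : Finset (Fin m))).filter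
        fun S => O (cliqueVec S) = true :=
      filter_congr fun S _ => by simp [Accepts]
    rw [this] at hP
    linarith
  · have hXl : #X ≤ l := (mem_smallSets.1 (h𝒜 hX)).1
    -- `Pr[⌈𝒜⌉] ≥ Pr[⌈X⌉] ≥ q^{C(l,2)}`
    have hAccPr : q ^ (l.choose 2) ≤ prob q (fun x : KEdge m → Bool => Accepts 𝒜 x) :=
      (pow_choose_le_prob_cliquePresent hq0 hq1 hXl).trans
        (prob_mono hq0 hq1 fun x hx => ⟨X, hX, hx⟩)
    -- inclusion–exclusion: `gainedNeg ≥ Pr[O = 0] + Pr[⌈𝒜⌉] - 1`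
    have hsplit := prob_eq_add_prob_and_not q (fun x : KEdge m → Bool => O x = false)
      (fun x => Accepts 𝒜 x)
    have hcomp : prob q (fun x : KEdge m → Bool => O x = false ∧ ¬ Accepts 𝒜 x) ≤
        1 - prob q (fun x : KEdge m → Bool => Accepts 𝒜 x) := by
      rw [← prob_not]
      exact prob_mono hq0 hq1 fun x hx => hx.2
    unfold gainedNeg at hN
    linarith

end PickedLineCopy

end Summit.PneNP.PneNP.Cruxes.LinAlgGateBlind.Disproof
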